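import Summits.QuantumFields.YangMills.Theorems.BalabanUVNodesN15CurvedGluingSmoothCutDressedGluedDefectGaugedTwisted
import Summits.QuantumFields.YangMills.Theorems.BalabanUVNodesN15CurvedGluingSmoothCutDressedGluedDefectGaugedUN
import HarnessLib

/-!
# N15 = NE2, road (c) — PROGRAMME (PC) «[B9] Sect. C FOR THE LANDAU LETTER WITH PER-CUBE GAUGES (3.35) AS PRINTED», (PC-E) (C4) OF THE AMENDED ARCHITECTURE: THE TWISTED EDITION OF
# dag-n15-w3's FILE 53 — THE TWO-GRID η-DEFECT OF THE GLUED PROPAGATORS OF BAŁABAN's COVARIANT OPERATORS `Δ_{R_U} + P` AT GENUINE `U(m)` BACKGROUNDS ON BOTH GRIDS, EACH CUBE IN ITS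
# OWN UNITARY FINE GAUGE `u′_k` AND THE INDUCED COARSE GAUGE `u′_k∘σ`, THROUGH THE TWISTED TRANSPORT — NO GAUGE FIT (dag-n15-c g31, n15-c∕335)

Cell `pub-ymgap`, seat `pub-ymgap-dag-n15-c` (generation g31; R134 (a) seat, strategy s1 «first missing estimate»; HUMAN RULING D-0062; chair R424 venue).
`bears_on: R4∕N15 · K3⁸ SpineGivenEndpointR13SepCoPHV (stmt-QuantumFields-27366)`; filed `--kind proof --supports stmt-QuantumFields-27366 --as helper` — COUNT-NEUTRAL.
ONE theorem, 0 `def`, 0 `sorry`; bookkeeping over landed rows, NO new estimate.  Imports BY NAME n15-c∕334 `…SmoothCutDressedGluedDefectGaugedTwisted` (★★★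
`hasMaj_idef_glueInv_smoothCutDressed_localGauges_tr`), dag-n15-w3 FILE 53 `…SmoothCutDressedGluedDefectGaugedUN` (`uN_localOp_eq_cut_add_farDefect`; through it FILE 51 `hasMaj_cutPert_structural_of_local` ∕
`hasMaj_idef_cutPert_structural_of_local`, files 49∕50 `hasMaj_mulOp_farDefect_smoothCutDressed` ∕ `hasMaj_commOp_farDefect_structural` ∕ `hasMaj_idef_commOp_farDefect_structural` ∕
`hasMaj_idef_mulOp_farDefect_structural`, dag-n15-w2 `uN_siteGauge_orthogonal`).  Nothing in the tree is modified, no landed name re-declared; FILE 53 `uN_hasMaj_idef_glueInv_smoothCutDressed_localGauges` (flat pull-back + gauge fit `o_W`) stays as it is — this is a NEW sibling.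

WHY (director-ym I.20786∕I.20907; `PCE-DESIGN-g31.md` §5 (3), §6).  FILE 53 is the `U(m)` edition of FILE 48: sixteen of 48's slots discharged BY NAME from unitary data (orthogonality of
`Ad(u_k)`, the covariance identities in cut-plus-far form, the cube perturbations' letters and η-defects from the LOCAL species letters of the transformed bond variables `u_kUu_kᴴ`, the
far-defect rows), at the price of a gauge FIT `o_W` between `Ad(u′_k)` and `Ad(u_k)∘π` — false for the rough gauges of (3.35).  THIS FILE is FILE 53's statement and proof VERBATIM with
(1) the coarse gauge INDUCED, `u_k := u′_k∘σ` (so every `u_k x` of FILE 53 reads `u′_k (σ x)`: the transformed coarse bond variables are `u′_k(σx)U_μ(x)u′_k(σ(x+e_μ))ᴴ`), (2) the fit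
hypotheses `hfitW∕hfitWT∕o_W` and `hu` REPLACED by the twisted transport's factorization `hTk` (`T = M_{Ad(u′_k)ᵀ}(M_{S_kᵀ}∘pull)M_{Ad(u′_k∘σ)}` — dag-n15-a `ctauS_gauge` ∕ n15-c∕331
`ctauV_eq_conj_gaugeTb` on the torus), its product form `hT0` (`|Ψᵀ| ≤ 1`), the coarse output supports `ψᵒ_k` and the SMEARED stair letters `s` (✓p793284 on the cube's box), and
(3) ONE application of n15-c∕334 instead of FILE 48: ★★★ `uN_hasMaj_idef_glueInv_smoothCutDressed_localGauges_tr` — `𝔇_T(𝒢′, 𝒢) ≤ C·e^{−(ρ₃−2σ)d}` with `C` = FILE 53's constant at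
`o_W = 0` plus the stair terms and the partition row `|ι|·oo` (written out below).  Sequel (C5): the SITE instantiation for the scalar covariant Green's function `G′(U)` of (3.25) —
n15-c∕262's knit objects on both grids, `T := ctauS`, dag-n15-a's (m4)-A rows ✓p794216∕✓p794355, the letters per box from `Reg335Cube` and the covariant fit of PAIRING (i).

HONEST FRAMING ∕ LIMITS.  Composition of LANDED theorems — the operator-level η-rate content of NE2 for Bałaban's covariant operators at genuine non-abelian backgrounds with (3.35)'s
per-cube gauges, as a CONDITIONAL statement over DISPLAYED rows on King's ∕ dag-n15-a's model carriers; the fine gauges `u′_k` with the (3.35) letters of `u′_kU′u′_kᴴ` AND of the coarse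
`(u′_k∘σ)U(u′_k∘σ)ᴴ` on the cube and their fits across `π`, the transport's factorization ∕ stair letters ∕ supports, Bałaban's `P`, `P′` and their conjugation laws, `N_V`'s letters and
FILE 45's rows are HYPOTHESES (located producers: `Reg335Cube` per box on both grids + the covariant fit of pairing (i) — (C5)); nothing of [B5]∕[B6]∕[B9] asserted ((3.34)–(3.35),
(3.42), (3.50)–(3.53), (3.62)–(3.65), Thm 3.14 = SHAPES ∕ TEMPLATE).  NE2⁺ NOT PRINTED, NOT proved; N15 of record untouched (DISCHARGED AS CONSUMED, p687738); K3⁸ OPEN; counts of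
record UNMOVED (typed 28∕28 · discharged 8∕27); one finite 𝕋⁴ at fixed ε per index — NOT infinite volume, NOT OS on ℝ⁴, NOT a mass gap, NOT Clay; R4 closes the conditional finite-𝕋⁴
rung `BalabanLadder.UV` only.  Restate-immune (no Theses import).
-/

set_option autoImplicit false

noncomputable section
open scoped BigOperators Matrix Matrix.Norms.Frobenius
open Finset

namespace Summit.QuantumFields.YangMills.BalabanUVNodes.N15.CurvedSpecies

open Literature.MathematicalPhysics.QuantumFieldTheory.Balaban1983to89
open Literature.MathematicalPhysics.QuantumFieldTheory.Balaban1983to89.B11SectG (BlockNorm HasMaj RowSum hasMaj_zero)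
open Literature.MathematicalPhysics.QuantumFieldTheory.Balaban1983to89.B6RandomWalk (Triangle254)
open Literature.MathematicalPhysics.QuantumFieldTheory.Balaban1983to89.T4EtaRateDefect (idef idef_add)
open Literature.MathematicalPhysics.QuantumFieldTheory.Balaban1983to89.T4EtaRateCoeffDefect (pull)
open Literature.MathematicalPhysics.QuantumFieldTheory.Balaban1983to89.B6Prop26Gluing (mulOp mulOp_apply ind ind_nonneg ind_le_one)
open Summit.QuantumFields.YangMills.BalabanUVNodes.N15.MatrixSpecies (mmulOp liftBlk liftMap liftEquiv liftEquiv_apply liftEquiv_symm_apply coordMat)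
open Summit.QuantumFields.YangMills.BalabanUVNodes.N15.BackgroundLayer (fgrad bgrad fgradAdj stack projO blkPair liftPair bgPropV covLapM tCoefA tCoefC unstackM projO_none_comp_stack)
open Summit.QuantumFields.YangMills.BalabanUVNodes.N15.Gluing (commOp lapOp parametrix remainder glueInv)
open Literature.Barriers.QuantumFields (traceForm)

variable {X X' ι J K : Type} [Fintype X] [Fintype X'] [DecidableEq X] [DecidableEq X'] [Fintype ι] [DecidableEq ι] [Fintype J] [DecidableEq J] [Fintype K] {g : B6.Geometry}
  (blk : X → g.Site) (π : X' → X) (sec : X → X') (τ : J → X ≃ X) (τ' : J → X' ≃ X') {σ cr : ℝ} (T : (X × ι → ℝ) →ₗ[ℝ] (X' × ι → ℝ)) {St : K → X' → Matrix ι ι ℝ} {Ψ : X' → Matrix ι ι ℝ}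
  {N : K → (X × ι → ℝ) →ₗ[ℝ] (X × ι → ℝ)} {N' : K → (X' × ι → ℝ) →ₗ[ℝ] (X' × ι → ℝ)} {NL : (X × ι → ℝ) →ₗ[ℝ] (X × ι → ℝ)} {NL' : (X' × ι → ℝ) →ₗ[ℝ] (X' × ι → ℝ)}
  {χX χtX ψX hX ψo : K → X → ℝ} {χX' χtX' ψX' hX' : K → X' → ℝ} {Sk : K → Set g.Site} {hb : K → g.Site → ℝ}
  {β β₁ ct m₀ m₁ oχ oχ₁ oχ₂ δ : ℝ}

set_option maxHeartbeats 400000 in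
/-- ★★★ **THE TWO-GRID η-DEFECT OF THE GLUED PROPAGATORS OF BAŁABAN's COVARIANT OPERATORS `Δ_{R_U} + P` (coarse, spacing `η`) AND `Δ′_{R_{U′}} + P′` (fine, spacing `η′`) FROM DRESSED
SMOOTH-CUT CUBES, EACH CUBE IN ITS OWN UNITARY FINE GAUGE `u′_k` AND THE INDUCED COARSE GAUGE `u′_k∘σ`, THROUGH THE TWISTED TRANSPORT `T` — NO GAUGE FIT** (the twisted edition of FILE 53): n15-c∕334's capstone
`hasMaj_idef_glueInv_smoothCutDressed_localGauges_tr` with the per-cube fine gauges `W′_k = coordMat e (Ad_{u′_k})` of UNITARY site fields and the INDUCED coarse gauges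
`coordMat e (Ad_{u′_k∘σ})`, the GLOBAL operators of the UNITARY bond variables `U`, `U′`, the cube perturbations = the species of the transformed bond variables `(u′_k∘σ)U(u′_k∘σ)ᴴ`,
`u′_kU′u′_kᴴ` CUT to the cube plus the cut nonlocal perturbations, FILE 53's slots DISCHARGED BY NAME exactly as there (orthogonality `uN_siteGauge_orthogonal`, the covariance identities
`uN_localOp_eq_cut_add_farDefect` + `hP`∕`hP′`, the perturbations' letters and η-defect from the LOCAL species letters and cut fits (file 51), the far-defect rows and η-defects (files 49∕50),
`W = 0 = W′`), and the two grids compared through the twisted transport `T` (factorization `hTk`, product form `hT0`, output supports `ψᵒ_k`, smeared stair letters `s`) — NO gauge fit.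
Displayed: FILE 45's rows, `M_{W_k}PM_{W_kᵀ} = N_L − N_V k` (both grids), the (3.35) letters IN THE CUBE GAUGES and their fits, the letters ∕ far letters ∕ η-defects of `N_V`, the supports.
[cite: Balaban1985BackgroundPropagators, (3.34)–(3.35) p.396, (3.42) p.397, Thm 3.14 pp.426–427 (template), (3.50)–(3.53) p.400, (3.62)–(3.65) pp.402–403, (3.76)–(3.77) p.406 (mechanism);
Balaban1984PropagatorsII, (2.91) p.239, (2.133)–(2.136) p.247; Balaban1985Averaging, (125) p.36 (the transport: shape); King1986, p.664 (pairing)] -/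
theorem uN_hasMaj_idef_glueInv_smoothCutDressed_localGauges_tr {m : Type} [Fintype m] [DecidableEq m] (e : Matrix m m ℂ ≃L[ℝ] (ι → ℝ)) {u' : K → X' → Matrix m m ℂ}
    {U : J → X → Matrix m m ℂ} {U' : J → X' → Matrix m m ℂ} {P : (X × ι → ℝ) →ₗ[ℝ] (X × ι → ℝ)} {P' : (X' × ι → ℝ) →ₗ[ℝ] (X' × ι → ℝ)} {NV : K → (X × ι → ℝ) →ₗ[ℝ] (X × ι → ℝ)}
    {NV' : K → (X' × ι → ℝ) →ₗ[ℝ] (X' × ι → ℝ)} (η η' : ℝ) (htri : Triangle254 g) (hd : ∀ a b : g.Site, 0 ≤ g.dist a b) (hd0 : ∀ y : g.Site, g.dist y y = 0)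
    (hsymm : ∀ y y', g.dist y y' = g.dist y' y) (hrow : RowSum g σ cr) (hσ : 0 ≤ σ) (hcr : 0 ≤ cr)
    {ρ₁ ρ₂ ρ₃ ρN ρT δV ε R o c₁ c₂ o₁ o₂ rW θW cN rN ℓ ω d₁ oo ε₀ rF Nov s : ℝ} (hβ : 0 ≤ β) (hβ₁ : 0 ≤ β₁) (hct : 0 ≤ ct) (hm₀ : 0 ≤ m₀) (hm₁ : 0 ≤ m₁)
    (hoχ : 0 ≤ oχ) (hoχ₁ : 0 ≤ oχ₁) (hoχ₂ : 0 ≤ oχ₂) (hR : 0 ≤ R) (ho : 0 ≤ o) (hσρ : σ ≤ ρ₁) (hρ₁V : ρ₁ ≤ δV) (hρ₁G : ρ₁ + σ ≤ δ) (hρ₂ : 0 ≤ ρ₂) (hρ₂₁ : ρ₂ + σ ≤ ρ₁)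
    (hρ₂T : ρ₂ + σ ≤ ρT) (hρ₃ : 0 ≤ ρ₃) (hρ₃₂ : ρ₃ ≤ ρ₂) (hρ₃V : ρ₃ + σ ≤ δV - ε) (hρ₃N : ρ₃ + σ ≤ ρN) (hσρ₃ : 2 * σ ≤ ρ₃) (hε : 0 < ε) (hc₁ : 0 ≤ c₁) (hc₂ : 0 ≤ c₂)
    (ho₁ : 0 ≤ o₁) (ho₂ : 0 ≤ o₂) (hrW : 0 ≤ rW) (hθW : 0 ≤ θW) (hcN : 0 ≤ cN) (hrN : 0 ≤ rN) (hℓ : 0 ≤ ℓ) (hω : 0 ≤ ω) (hd₁ : 0 ≤ d₁) (hoo : 0 ≤ oo) (hε₀ : 0 ≤ ε₀)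
    (hrF : 0 ≤ rF) (hNov : 0 ≤ Nov) (hn : 0 < η⁻¹) (hn' : 0 < η'⁻¹)
    (hSχ : ∀ k, ∀ x, (χX k) x ≠ 0 → blk x ∈ (Sk k)) (hSψ : ∀ k, ∀ x, (ψX k) x ≠ 0 → blk x ∈ (Sk k)) (hSχ' : ∀ k, ∀ x', (χX' k) x' ≠ 0 → blk (π x') ∈ (Sk k)) (hSψ' : ∀ k, ∀ x', (ψX' k) x' ≠ 0 → blk (π x') ∈ (Sk k))
    -- coarse bump data
    (hχt : ∀ k, ∀ x, |(χtX k) x| ≤ 1)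
    (hdχt : ∀ k, ∀ μ p, |fgrad η⁻¹ (liftEquiv (τ μ) ι) (fun p : X × ι => (χtX k) p.1) p| ≤ ct) (hdχtb : ∀ k, ∀ μ p, |bgrad η⁻¹ (liftEquiv (τ μ) ι) (fun p : X × ι => (χtX k) p.1) p| ≤ ct)
    (hsub : ∀ k, mulOp (fun p : X × ι => (χtX k) p.1) ∘ₗ mulOp (fun p : X × ι => (χX k) p.1) = mulOp (fun p : X × ι => (χtX k) p.1))
    (hχ : ∀ k, mulOp (fun p : X × ι => (χX k) p.1) ∘ₗ mulOp (fun p : X × ι => (χtX k) p.1) = mulOp (fun p : X × ι => (χtX k) p.1))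
    (hs : ∀ k, ∀ μ, mulOp ((fun p : X × ι => (χtX k) p.1) ∘ (liftEquiv (τ μ) ι)) ∘ₗ mulOp (fun p : X × ι => (χX k) p.1) = mulOp ((fun p : X × ι => (χtX k) p.1) ∘ (liftEquiv (τ μ) ι)))
    (hsb : ∀ k, ∀ μ, mulOp ((fun p : X × ι => (χtX k) p.1) ∘ (liftEquiv (τ μ) ι).symm) ∘ₗ mulOp (fun p : X × ι => (χX k) p.1) = mulOp ((fun p : X × ι => (χtX k) p.1) ∘ (liftEquiv (τ μ) ι).symm))
    (hdd : ∀ k, ∀ μ, mulOp (fgrad η⁻¹ (liftEquiv (τ μ) ι) (fun p : X × ι => (χtX k) p.1)) ∘ₗ mulOp (fun p : X × ι => (χX k) p.1) = mulOp (fgrad η⁻¹ (liftEquiv (τ μ) ι) (fun p : X × ι => (χtX k) p.1)))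
    (hddb : ∀ k, ∀ μ, mulOp (bgrad η⁻¹ (liftEquiv (τ μ) ι) (fun p : X × ι => (χtX k) p.1)) ∘ₗ mulOp (fun p : X × ι => (χX k) p.1) = mulOp (bgrad η⁻¹ (liftEquiv (τ μ) ι) (fun p : X × ι => (χtX k) p.1)))
    (hNψ : ∀ k, (N k) ∘ₗ mulOp (fun p : X × ι => (ψX k) p.1) = (N k))
    -- fine bump data
    (hχt' : ∀ k, ∀ x', |(χtX' k) x'| ≤ 1)
    (hdχt' : ∀ k, ∀ μ p', |fgrad η'⁻¹ (liftEquiv (τ' μ) ι) (fun p' : X' × ι => (χtX' k) p'.1) p'| ≤ ct) (hdχtb' : ∀ k, ∀ μ p', |bgrad η'⁻¹ (liftEquiv (τ' μ) ι) (fun p' : X' × ι => (χtX' k) p'.1) p'| ≤ ct)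
    (hsub' : ∀ k, mulOp (fun p : X' × ι => (χtX' k) p.1) ∘ₗ mulOp (fun p : X' × ι => (χX' k) p.1) = mulOp (fun p : X' × ι => (χtX' k) p.1))
    (hχ' : ∀ k, mulOp (fun p : X' × ι => (χX' k) p.1) ∘ₗ mulOp (fun p : X' × ι => (χtX' k) p.1) = mulOp (fun p : X' × ι => (χtX' k) p.1))
    (hs' : ∀ k, ∀ μ, mulOp ((fun p' : X' × ι => (χtX' k) p'.1) ∘ (liftEquiv (τ' μ) ι)) ∘ₗ mulOp (fun p' : X' × ι => (χX' k) p'.1) = mulOp ((fun p' : X' × ι => (χtX' k) p'.1) ∘ (liftEquiv (τ' μ) ι)))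
    (hsb' : ∀ k, ∀ μ, mulOp ((fun p' : X' × ι => (χtX' k) p'.1) ∘ (liftEquiv (τ' μ) ι).symm) ∘ₗ mulOp (fun p' : X' × ι => (χX' k) p'.1) =
      mulOp ((fun p' : X' × ι => (χtX' k) p'.1) ∘ (liftEquiv (τ' μ) ι).symm))
    (hdd' : ∀ k, ∀ μ, mulOp (fgrad η'⁻¹ (liftEquiv (τ' μ) ι) (fun p' : X' × ι => (χtX' k) p'.1)) ∘ₗ mulOp (fun p' : X' × ι => (χX' k) p'.1) = mulOp (fgrad η'⁻¹ (liftEquiv (τ' μ) ι) (fun p' : X' × ι => (χtX' k) p'.1)))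
    (hddb' : ∀ k, ∀ μ, mulOp (bgrad η'⁻¹ (liftEquiv (τ' μ) ι) (fun p' : X' × ι => (χtX' k) p'.1)) ∘ₗ mulOp (fun p' : X' × ι => (χX' k) p'.1) = mulOp (bgrad η'⁻¹ (liftEquiv (τ' μ) ι) (fun p' : X' × ι => (χtX' k) p'.1)))
    (hNψ' : ∀ k, (N' k) ∘ₗ mulOp (fun p : X' × ι => (ψX' k) p.1) = (N' k))
    -- fits of the bumps across `π`
    (hfitχ : ∀ k, ∀ x', |(χtX' k) x' - (χtX k) (π x')| ≤ oχ)
    (hfit₁ : ∀ k, ∀ μ p', |((fun p' : X' × ι => (χtX' k) p'.1) ∘ (liftEquiv (τ' μ) ι)) p' - ((fun p : X × ι => (χtX k) p.1) ∘ (liftEquiv (τ μ) ι)) (liftMap π ι p')| ≤ oχ₁)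
    (hfit₁b : ∀ k, ∀ μ p', |((fun p' : X' × ι => (χtX' k) p'.1) ∘ (liftEquiv (τ' μ) ι).symm) p' - ((fun p : X × ι => (χtX k) p.1) ∘ (liftEquiv (τ μ) ι).symm) (liftMap π ι p')| ≤ oχ₁)
    (hfit₂ : ∀ k, ∀ μ p', |fgrad η'⁻¹ (liftEquiv (τ' μ) ι) (fun p' : X' × ι => (χtX' k) p'.1) p' - fgrad η⁻¹ (liftEquiv (τ μ) ι) (fun p : X × ι => (χtX k) p.1) (liftMap π ι p')| ≤ oχ₂)
    (hfit₂b : ∀ k, ∀ μ p', |bgrad η'⁻¹ (liftEquiv (τ' μ) ι) (fun p' : X' × ι => (χtX' k) p'.1) p' - bgrad η⁻¹ (liftEquiv (τ μ) ι) (fun p : X × ι => (χtX k) p.1) (liftMap π ι p')| ≤ oχ₂)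
    -- cut rows and their defects
    (hcut : ∀ k, HasMaj (BlockNorm.ofBlocks g (liftBlk blk ι)) (BlockNorm.ofBlocks g (liftBlk blk ι)) (mulOp (fun p : X × ι => (χX k) p.1) ∘ₗ (N k))
      (fun y y' => ind (Sk k) y * ind (Sk k) y' * (β * Real.exp (-(δ * g.dist y y')))))
    (hcutF : ∀ k, ∀ μ, HasMaj (BlockNorm.ofBlocks g (liftBlk blk ι)) (BlockNorm.ofBlocks g (liftBlk blk ι)) (mulOp (fun p : X × ι => (χX k) p.1) ∘ₗ (fgrad η⁻¹ (liftEquiv (τ μ) ι) ∘ₗ (N k)))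
      (fun y y' => ind (Sk k) y * ind (Sk k) y' * (β₁ * Real.exp (-(δ * g.dist y y')))))
    (hcutB : ∀ k, ∀ μ, HasMaj (BlockNorm.ofBlocks g (liftBlk blk ι)) (BlockNorm.ofBlocks g (liftBlk blk ι)) (mulOp (fun p : X × ι => (χX k) p.1) ∘ₗ (bgrad η⁻¹ (liftEquiv (τ μ) ι) ∘ₗ (N k)))
      (fun y y' => ind (Sk k) y * ind (Sk k) y' * (β₁ * Real.exp (-(δ * g.dist y y')))))
    (hcut' : ∀ k, HasMaj (BlockNorm.ofBlocks g (liftBlk (blk ∘ π) ι)) (BlockNorm.ofBlocks g (liftBlk (blk ∘ π) ι)) (mulOp (fun p : X' × ι => (χX' k) p.1) ∘ₗ (N' k))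
      (fun y y' => ind (Sk k) y * ind (Sk k) y' * (β * Real.exp (-(δ * g.dist y y')))))
    (hcutF' : ∀ k, ∀ μ, HasMaj (BlockNorm.ofBlocks g (liftBlk (blk ∘ π) ι)) (BlockNorm.ofBlocks g (liftBlk (blk ∘ π) ι)) (mulOp (fun p : X' × ι => (χX' k) p.1) ∘ₗ (fgrad η'⁻¹ (liftEquiv (τ' μ) ι) ∘ₗ (N' k)))
      (fun y y' => ind (Sk k) y * ind (Sk k) y' * (β₁ * Real.exp (-(δ * g.dist y y')))))
    (hcutB' : ∀ k, ∀ μ, HasMaj (BlockNorm.ofBlocks g (liftBlk (blk ∘ π) ι)) (BlockNorm.ofBlocks g (liftBlk (blk ∘ π) ι)) (mulOp (fun p : X' × ι => (χX' k) p.1) ∘ₗ (bgrad η'⁻¹ (liftEquiv (τ' μ) ι) ∘ₗ (N' k)))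
      (fun y y' => ind (Sk k) y * ind (Sk k) y' * (β₁ * Real.exp (-(δ * g.dist y y')))))
    (hDcut : ∀ k, HasMaj (BlockNorm.ofBlocks g (liftBlk blk ι)) (BlockNorm.ofBlocks g (liftBlk blk ι ∘ liftMap π ι))
      (idef (pull (liftMap π ι)) (pull (liftMap π ι)) (mulOp (fun p : X' × ι => (χX' k) p.1) ∘ₗ (N' k)) (mulOp (fun p : X × ι => (χX k) p.1) ∘ₗ (N k)))
      (fun y y' => ind (Sk k) y * ind (Sk k) y' * (m₀ * Real.exp (-(δ * g.dist y y')))))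
    (hDcutF : ∀ k, ∀ μ, HasMaj (BlockNorm.ofBlocks g (liftBlk blk ι)) (BlockNorm.ofBlocks g (liftBlk blk ι ∘ liftMap π ι))
      (idef (pull (liftMap π ι)) (pull (liftMap π ι)) (mulOp (fun p : X' × ι => (χX' k) p.1) ∘ₗ (fgrad η'⁻¹ (liftEquiv (τ' μ) ι) ∘ₗ (N' k))) (mulOp (fun p : X × ι => (χX k) p.1) ∘ₗ (fgrad η⁻¹ (liftEquiv (τ μ) ι) ∘ₗ (N k))))
      (fun y y' => ind (Sk k) y * ind (Sk k) y' * (m₁ * Real.exp (-(δ * g.dist y y')))))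
    (hDcutB : ∀ k, ∀ μ, HasMaj (BlockNorm.ofBlocks g (liftBlk blk ι)) (BlockNorm.ofBlocks g (liftBlk blk ι ∘ liftMap π ι))
      (idef (pull (liftMap π ι)) (pull (liftMap π ι)) (mulOp (fun p : X' × ι => (χX' k) p.1) ∘ₗ (bgrad η'⁻¹ (liftEquiv (τ' μ) ι) ∘ₗ (N' k))) (mulOp (fun p : X × ι => (χX k) p.1) ∘ₗ (bgrad η⁻¹ (liftEquiv (τ μ) ι) ∘ₗ (N k))))
      (fun y y' => ind (Sk k) y * ind (Sk k) y' * (m₁ * Real.exp (-(δ * g.dist y y')))))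
    -- the jet pieces' reversed insertions (output cut-offs), both grids
    (hs2 : ∀ k, ∀ μ, mulOp (fun p : X × ι => (χX k) p.1) ∘ₗ mulOp ((fun p : X × ι => (χtX k) p.1) ∘ (liftEquiv (τ μ) ι)) = mulOp ((fun p : X × ι => (χtX k) p.1) ∘ (liftEquiv (τ μ) ι)))
    (hsb2 : ∀ k, ∀ μ, mulOp (fun p : X × ι => (χX k) p.1) ∘ₗ mulOp ((fun p : X × ι => (χtX k) p.1) ∘ (liftEquiv (τ μ) ι).symm) = mulOp ((fun p : X × ι => (χtX k) p.1) ∘ (liftEquiv (τ μ) ι).symm))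
    (hdd2 : ∀ k, ∀ μ, mulOp (fun p : X × ι => (χX k) p.1) ∘ₗ mulOp (fgrad η⁻¹ (liftEquiv (τ μ) ι) (fun p : X × ι => (χtX k) p.1)) = mulOp (fgrad η⁻¹ (liftEquiv (τ μ) ι) (fun p : X × ι => (χtX k) p.1)))
    (hddb2 : ∀ k, ∀ μ, mulOp (fun p : X × ι => (χX k) p.1) ∘ₗ mulOp (bgrad η⁻¹ (liftEquiv (τ μ) ι) (fun p : X × ι => (χtX k) p.1)) = mulOp (bgrad η⁻¹ (liftEquiv (τ μ) ι) (fun p : X × ι => (χtX k) p.1)))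
    (hs2' : ∀ k, ∀ μ, mulOp (fun p' : X' × ι => (χX' k) p'.1) ∘ₗ mulOp ((fun p' : X' × ι => (χtX' k) p'.1) ∘ (liftEquiv (τ' μ) ι)) = mulOp ((fun p' : X' × ι => (χtX' k) p'.1) ∘ (liftEquiv (τ' μ) ι)))
    (hsb2' : ∀ k, ∀ μ, mulOp (fun p' : X' × ι => (χX' k) p'.1) ∘ₗ mulOp ((fun p' : X' × ι => (χtX' k) p'.1) ∘ (liftEquiv (τ' μ) ι).symm) =
      mulOp ((fun p' : X' × ι => (χtX' k) p'.1) ∘ (liftEquiv (τ' μ) ι).symm))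
    (hdd2' : ∀ k, ∀ μ, mulOp (fun p' : X' × ι => (χX' k) p'.1) ∘ₗ mulOp (fgrad η'⁻¹ (liftEquiv (τ' μ) ι) (fun p' : X' × ι => (χtX' k) p'.1)) = mulOp (fgrad η'⁻¹ (liftEquiv (τ' μ) ι) (fun p' : X' × ι => (χtX' k) p'.1)))
    (hddb2' : ∀ k, ∀ μ, mulOp (fun p' : X' × ι => (χX' k) p'.1) ∘ₗ mulOp (bgrad η'⁻¹ (liftEquiv (τ' μ) ι) (fun p' : X' × ι => (χtX' k) p'.1)) = mulOp (bgrad η'⁻¹ (liftEquiv (τ' μ) ι) (fun p' : X' × ι => (χtX' k) p'.1)))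
    (hq : (β + (β₁ + ct * β)) * (R * cr) * cr < 1)
    (hh1 : ∀ k, ∀ μ p, |fgrad η⁻¹ (liftEquiv (τ μ) ι) (fun p : X × ι => hX k p.1) p| ≤ c₁) (hh1b : ∀ k, ∀ μ p, |bgrad η⁻¹ (liftEquiv (τ μ) ι) (fun p : X × ι => hX k p.1) p| ≤ c₁)
    (hh1' : ∀ k, ∀ μ p', |fgrad η'⁻¹ (liftEquiv (τ' μ) ι) (fun p : X' × ι => hX' k p.1) p'| ≤ c₁) (hh1b' : ∀ k, ∀ μ p', |bgrad η'⁻¹ (liftEquiv (τ' μ) ι) (fun p : X' × ι => hX' k p.1) p'| ≤ c₁)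
    (hh2' : ∀ k, ∀ μ p', |fgradAdj η'⁻¹ (liftEquiv (τ' μ) ι) (fgrad η'⁻¹ (liftEquiv (τ' μ) ι) (fun p : X' × ι => hX' k p.1)) p'| ≤ c₂)
    (hf1 : ∀ k, ∀ μ p', |fgrad η'⁻¹ (liftEquiv (τ' μ) ι) (fun p : X' × ι => hX' k p.1) p' - fgrad η⁻¹ (liftEquiv (τ μ) ι) (fun p : X × ι => hX k p.1) (liftMap π ι p')| ≤ o₁)
    (hf1b : ∀ k, ∀ μ p', |bgrad η'⁻¹ (liftEquiv (τ' μ) ι) (fun p : X' × ι => hX' k p.1) p' - bgrad η⁻¹ (liftEquiv (τ μ) ι) (fun p : X × ι => hX k p.1) (liftMap π ι p')| ≤ o₁)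
    (hf2 : ∀ k, ∀ μ p', |fgradAdj η'⁻¹ (liftEquiv (τ' μ) ι) (fgrad η'⁻¹ (liftEquiv (τ' μ) ι) (fun p : X' × ι => hX' k p.1)) p' - fgradAdj η⁻¹ (liftEquiv (τ μ) ι) (fgrad η⁻¹ (liftEquiv (τ μ) ι) (fun p : X × ι => hX k p.1)) (liftMap π ι p')| ≤ o₂)
    (hLip : ∀ k, ∀ y y', |(hb k) y - (hb k) y'| ≤ ℓ * g.dist y y') (hrh : ∀ k (p : X × ι), |hX k p.1 - (hb k) (liftBlk blk ι p)| ≤ ω) (hrh' : ∀ k (p' : X' × ι), |hX' k p'.1 - (hb k) (liftBlk (blk ∘ π) ι p')| ≤ ω)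
    (hfh : ∀ k (p' : X' × ι), |hX' k p'.1 - hX k (π p'.1)| ≤ oo) (hstep : ∀ μ x, g.dist (blk (τ μ x)) (blk x) ≤ d₁) (hstep' : ∀ μ x', g.dist (blk (π (τ' μ x'))) (blk (π x')) ≤ d₁)
    (hKN' : ∀ k, HasMaj (BlockNorm.ofBlocks g (liftBlk (blk ∘ π) ι)) (BlockNorm.ofBlocks g (liftBlk (blk ∘ π) ι)) (commOp NL' (fun p : X' × ι => hX' k p.1)) (fun y y' => cN * Real.exp (-(ρN * g.dist y y'))))
    (hDKN : ∀ k, HasMaj (BlockNorm.ofBlocks g (liftBlk blk ι)) (BlockNorm.ofBlocks g (liftBlk (blk ∘ π) ι))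
      (idef (pull (liftMap π ι)) (pull (liftMap π ι)) (commOp NL' (fun p : X' × ι => hX' k p.1)) (commOp NL (fun p : X × ι => hX k p.1))) (fun y y' => rN * Real.exp (-(ρN * g.dist y y'))))

    -- per cube, beyond file 39's data: the coarse second differences, the one-grid `W`-rows at both grids, the coarse `[N_L, M_h]` letter, the partition's sizes and cut support, the tail rows and their defect
    (hh2 : ∀ k, ∀ μ p, |fgradAdj η⁻¹ (liftEquiv (τ μ) ι) (fgrad η⁻¹ (liftEquiv (τ μ) ι) (fun p : X × ι => hX k p.1)) p| ≤ c₂)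
    (hKN : ∀ k, HasMaj (BlockNorm.ofBlocks g (liftBlk blk ι)) (BlockNorm.ofBlocks g (liftBlk blk ι)) (commOp NL (fun p : X × ι => hX k p.1)) (fun y y' => cN * Real.exp (-(ρN * g.dist y y'))))
    (hhabs : ∀ k x, |hX k x| ≤ 1) (hhabs' : ∀ k x', |hX' k x'| ≤ 1)
    (hhcut : ∀ k, mulOp (fun p : X × ι => hX k p.1) ∘ₗ mulOp (fun p : X × ι => χX k p.1) = mulOp (fun p : X × ι => hX k p.1)) (hhcut' : ∀ k, mulOp (fun p : X' × ι => hX' k p.1) ∘ₗ mulOp (fun p : X' × ι => χX' k p.1) = mulOp (fun p : X' × ι => hX' k p.1))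
    (hN : ∀ b, ∑ k, ind (Sk k) b ≤ Nov)
    (hT : ∀ k, HasMaj (BlockNorm.ofBlocks g (liftBlk blk ι)) (BlockNorm.ofBlocks g (liftBlk blk ι)) ((-(mulOp (fun p : X × ι => hX k p.1) ∘ₗ NL ∘ₗ mulOp (1 - fun p : X × ι => χtX k p.1))) ∘ₗ N k) (fun y y' => ind (Sk k) y * ind (Sk k) y' * (ε₀ * Real.exp (-(ρT * g.dist y y')))))
    (hT' : ∀ k, HasMaj (BlockNorm.ofBlocks g (liftBlk (blk ∘ π) ι)) (BlockNorm.ofBlocks g (liftBlk (blk ∘ π) ι)) ((-(mulOp (fun p : X' × ι => hX' k p.1) ∘ₗ NL' ∘ₗ mulOp (1 - fun p : X' × ι => χtX' k p.1))) ∘ₗ N' k) (fun y y' => ind (Sk k) y * ind (Sk k) y' * (ε₀ * Real.exp (-(ρT * g.dist y y')))))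
    (hDT : ∀ k, HasMaj (BlockNorm.ofBlocks g (liftBlk blk ι)) (BlockNorm.ofBlocks g (liftBlk (blk ∘ π) ι)) (idef (pull (liftMap π ι)) (pull (liftMap π ι)) ((-(mulOp (fun p : X' × ι => hX' k p.1) ∘ₗ NL' ∘ₗ mulOp (1 - fun p : X' × ι => χtX' k p.1))) ∘ₗ N' k) ((-(mulOp (fun p : X × ι => hX k p.1) ∘ₗ NL ∘ₗ mulOp (1 - fun p : X × ι => χtX k p.1))) ∘ₗ N k)) (fun y y' => ind (Sk k) y * ind (Sk k) y' * (rF * Real.exp (-(ρT * g.dist y y')))))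
    -- THE GAUGE GROUP OF RECORD ON BOTH GRIDS: trace-form coordinates `e` of `𝔤 = 𝔲(m)`, unitary per-cube FINE site gauges `u′_k` (the coarse gauge is the INDUCED `u′_k∘σ`), unitary bond variables `U`, `U′`,
    -- Bałaban's nonlocal summands `P`, `P′` read in the cube's gauges as the flat `N_L`, `N′_L` minus per-cube nonlocal perturbations `N_V k`, `N′_V k`; the species of the transformed bond
    -- variables SMALL WHERE `χ_k ≠ 0` ∕ `χ′_k ≠ 0` ((3.35) on the cube) and FITTING across `π` on the cut (species in the cube gauges); the letters, far letters and η-defects of `N_V k`, `N′_V k`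
    (he : ∀ A B : Matrix m m ℂ, traceForm A B = e A ⬝ᵥ e B) (hu' : ∀ k x', (u' k x')ᴴ * u' k x' = 1) {rV RN θF ρF rD oV oN : ℝ} (hrV : 0 ≤ rV)
    (hRN : 0 ≤ RN) (hθF : 0 ≤ θF) (hρF : ρ₃ + σ ≤ ρF) (hrD : 0 ≤ rD) (hoV : 0 ≤ oV) (hoN : 0 ≤ oN) (hRle : rV * (1 + Fintype.card (J ⊕ J)) + RN ≤ R) (hole : oV * (1 + Fintype.card (J ⊕ J)) + oN ≤ o)
    (hP : ∀ k, mmulOp (fun x => coordMat e (ContinuousLinearMap.mulLeftRight ℝ (Matrix m m ℂ) (u' k (sec x)) (u' k (sec x))ᴴ)) ∘ₗ P ∘ₗ mmulOp (fun x => (coordMat e (ContinuousLinearMap.mulLeftRight ℝ (Matrix m m ℂ) (u' k (sec x)) (u' k (sec x))ᴴ))ᵀ) = NL - NV k)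
    (hP' : ∀ k, mmulOp (fun x' => coordMat e (ContinuousLinearMap.mulLeftRight ℝ (Matrix m m ℂ) (u' k x') (u' k x')ᴴ)) ∘ₗ P' ∘ₗ mmulOp (fun x' => (coordMat e (ContinuousLinearMap.mulLeftRight ℝ (Matrix m m ℂ) (u' k x') (u' k x')ᴴ))ᵀ) = NL' - NV' k)
    (hχ1 : ∀ k x, |χX k x| ≤ 1) (hχ1' : ∀ k x', |χX' k x'| ≤ 1) (hψχ : ∀ k, mulOp (fun p : X × ι => ψX k p.1) ∘ₗ mulOp (fun p : X × ι => χX k p.1) = mulOp (fun p : X × ι => χX k p.1))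
    (hψχ' : ∀ k, mulOp (fun p : X' × ι => ψX' k p.1) ∘ₗ mulOp (fun p : X' × ι => χX' k p.1) = mulOp (fun p : X' × ι => χX' k p.1))
    (hCloc : ∀ k x, χX k x ≠ 0 → ∀ i, ∑ j, |tCoefC η (gaugePair τ fun μ x => coordMat e (ContinuousLinearMap.mulLeftRight ℝ (Matrix m m ℂ) (u' k (sec x) * U μ x * (u' k (sec (τ μ x)))ᴴ) (u' k (sec x) * U μ x * (u' k (sec (τ μ x)))ᴴ)ᴴ)) x i j| ≤ rV)
    (hAloc : ∀ k j' x, χX k x ≠ 0 → ∀ i, ∑ j, |tCoefA η (gaugePair τ fun μ x => coordMat e (ContinuousLinearMap.mulLeftRight ℝ (Matrix m m ℂ) (u' k (sec x) * U μ x * (u' k (sec (τ μ x)))ᴴ) (u' k (sec x) * U μ x * (u' k (sec (τ μ x)))ᴴ)ᴴ)) j' x i j| ≤ rV)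
    (hCloc' : ∀ k x', χX' k x' ≠ 0 → ∀ i, ∑ j, |tCoefC η' (gaugePair τ' fun μ x' => coordMat e (ContinuousLinearMap.mulLeftRight ℝ (Matrix m m ℂ) (u' k x' * U' μ x' * (u' k (τ' μ x'))ᴴ) (u' k x' * U' μ x' * (u' k (τ' μ x'))ᴴ)ᴴ)) x' i j| ≤ rV)
    (hAloc' : ∀ k j' x', χX' k x' ≠ 0 → ∀ i, ∑ j, |tCoefA η' (gaugePair τ' fun μ x' => coordMat e (ContinuousLinearMap.mulLeftRight ℝ (Matrix m m ℂ) (u' k x' * U' μ x' * (u' k (τ' μ x'))ᴴ) (u' k x' * U' μ x' * (u' k (τ' μ x'))ᴴ)ᴴ)) j' x' i j| ≤ rV)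
    (hfitC : ∀ k x' i, ∑ j, |(χX' k x' • tCoefC η' (gaugePair τ' fun μ x' => coordMat e (ContinuousLinearMap.mulLeftRight ℝ (Matrix m m ℂ) (u' k x' * U' μ x' * (u' k (τ' μ x'))ᴴ) (u' k x' * U' μ x' * (u' k (τ' μ x'))ᴴ)ᴴ)) x') i j - (χX k (π x') • tCoefC η (gaugePair τ fun μ x => coordMat e (ContinuousLinearMap.mulLeftRight ℝ (Matrix m m ℂ) (u' k (sec x) * U μ x * (u' k (sec (τ μ x)))ᴴ) (u' k (sec x) * U μ x * (u' k (sec (τ μ x)))ᴴ)ᴴ)) (π x')) i j| ≤ oV)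
    (hfitA : ∀ k j' x' i, ∑ j, |(χX' k x' • tCoefA η' (gaugePair τ' fun μ x' => coordMat e (ContinuousLinearMap.mulLeftRight ℝ (Matrix m m ℂ) (u' k x' * U' μ x' * (u' k (τ' μ x'))ᴴ) (u' k x' * U' μ x' * (u' k (τ' μ x'))ᴴ)ᴴ)) j' x') i j - (χX k (π x') • tCoefA η (gaugePair τ fun μ x => coordMat e (ContinuousLinearMap.mulLeftRight ℝ (Matrix m m ℂ) (u' k (sec x) * U μ x * (u' k (sec (τ μ x)))ᴴ) (u' k (sec x) * U μ x * (u' k (sec (τ μ x)))ᴴ)ᴴ)) j' (π x')) i j| ≤ oV)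
    (hNVcut : ∀ k, HasMaj (BlockNorm.ofBlocks g (liftBlk blk ι)) (BlockNorm.ofBlocks g (liftBlk blk ι)) (mulOp (fun p : X × ι => ψX k p.1) ∘ₗ NV k ∘ₗ mulOp (fun p : X × ι => χX k p.1)) (fun y y' => RN * Real.exp (-(δV * g.dist y y'))))
    (hNVcut' : ∀ k, HasMaj (BlockNorm.ofBlocks g (liftBlk (blk ∘ π) ι)) (BlockNorm.ofBlocks g (liftBlk (blk ∘ π) ι)) (mulOp (fun p : X' × ι => ψX' k p.1) ∘ₗ NV' k ∘ₗ mulOp (fun p : X' × ι => χX' k p.1)) (fun y y' => RN * Real.exp (-(δV * g.dist y y'))))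
    (hDNV : ∀ k, HasMaj (BlockNorm.ofBlocks g (liftBlk blk ι)) (BlockNorm.ofBlocks g (liftBlk (blk ∘ π) ι))
      (idef (pull (liftMap π ι)) (pull (liftMap π ι)) (mulOp (fun p : X' × ι => ψX' k p.1) ∘ₗ NV' k ∘ₗ mulOp (fun p : X' × ι => χX' k p.1)) (mulOp (fun p : X × ι => ψX k p.1) ∘ₗ NV k ∘ₗ mulOp (fun p : X × ι => χX k p.1))) (fun y y' => oN * Real.exp (-(δV * g.dist y y'))))
    (hfarN : ∀ k, HasMaj (BlockNorm.ofBlocks g (liftBlk blk ι)) (BlockNorm.ofBlocks g (liftBlk blk ι)) ((LinearMap.id - mulOp (fun p : X × ι => ψX k p.1)) ∘ₗ NV k ∘ₗ mulOp (fun p : X × ι => χX k p.1)) (fun y y' => θF * Real.exp (-(ρF * g.dist y y'))))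
    (hfarN' : ∀ k, HasMaj (BlockNorm.ofBlocks g (liftBlk (blk ∘ π) ι)) (BlockNorm.ofBlocks g (liftBlk (blk ∘ π) ι)) ((LinearMap.id - mulOp (fun p : X' × ι => ψX' k p.1)) ∘ₗ NV' k ∘ₗ mulOp (fun p : X' × ι => χX' k p.1)) (fun y y' => θF * Real.exp (-(ρF * g.dist y y'))))
    (hDfarN : ∀ k, HasMaj (BlockNorm.ofBlocks g (liftBlk blk ι)) (BlockNorm.ofBlocks g (liftBlk (blk ∘ π) ι)) (idef (pull (liftMap π ι)) (pull (liftMap π ι)) ((LinearMap.id - mulOp (fun p : X' × ι => ψX' k p.1)) ∘ₗ NV' k ∘ₗ mulOp (fun p : X' × ι => χX' k p.1))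
      ((LinearMap.id - mulOp (fun p : X × ι => ψX k p.1)) ∘ₗ NV k ∘ₗ mulOp (fun p : X × ι => χX k p.1))) (fun y y' => rD * Real.exp (-(ρF * g.dist y y'))))
    -- supports of the partitions inside `ψ_k`, `χ_k` ∕ `ψ′_k`, `χ′_k` (with shifts and differences), both grids
    (hhψ : ∀ k, mulOp (fun p : X × ι => hX k p.1) ∘ₗ mulOp (fun p : X × ι => ψX k p.1) = mulOp (fun p : X × ι => hX k p.1)) (hχh : ∀ k, mulOp (fun p : X × ι => χX k p.1) ∘ₗ mulOp (fun p : X × ι => hX k p.1) = mulOp (fun p : X × ι => hX k p.1))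
    (hhs' : ∀ k μ, mulOp (fun p : X × ι => χX k p.1) ∘ₗ mulOp ((fun p : X × ι => hX k p.1) ∘ (liftEquiv (τ μ) ι)) = mulOp ((fun p : X × ι => hX k p.1) ∘ (liftEquiv (τ μ) ι)))
    (hhsb' : ∀ k μ, mulOp (fun p : X × ι => χX k p.1) ∘ₗ mulOp ((fun p : X × ι => hX k p.1) ∘ (liftEquiv (τ μ) ι).symm) = mulOp ((fun p : X × ι => hX k p.1) ∘ (liftEquiv (τ μ) ι).symm))
    (hhdd' : ∀ k μ, mulOp (fun p : X × ι => χX k p.1) ∘ₗ mulOp (fgrad η⁻¹ (liftEquiv (τ μ) ι) (fun p : X × ι => hX k p.1)) = mulOp (fgrad η⁻¹ (liftEquiv (τ μ) ι) (fun p : X × ι => hX k p.1)))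
    (hhddb' : ∀ k μ, mulOp (fun p : X × ι => χX k p.1) ∘ₗ mulOp (bgrad η⁻¹ (liftEquiv (τ μ) ι) (fun p : X × ι => hX k p.1)) = mulOp (bgrad η⁻¹ (liftEquiv (τ μ) ι) (fun p : X × ι => hX k p.1)))
    (hhψf : ∀ k, mulOp (fun p : X' × ι => hX' k p.1) ∘ₗ mulOp (fun p : X' × ι => ψX' k p.1) = mulOp (fun p : X' × ι => hX' k p.1)) (hχhf : ∀ k, mulOp (fun p : X' × ι => χX' k p.1) ∘ₗ mulOp (fun p : X' × ι => hX' k p.1) = mulOp (fun p : X' × ι => hX' k p.1))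
    (hhsf : ∀ k μ, mulOp (fun p : X' × ι => χX' k p.1) ∘ₗ mulOp ((fun p : X' × ι => hX' k p.1) ∘ (liftEquiv (τ' μ) ι)) = mulOp ((fun p : X' × ι => hX' k p.1) ∘ (liftEquiv (τ' μ) ι)))
    (hhsbf : ∀ k μ, mulOp (fun p : X' × ι => χX' k p.1) ∘ₗ mulOp ((fun p : X' × ι => hX' k p.1) ∘ (liftEquiv (τ' μ) ι).symm) = mulOp ((fun p : X' × ι => hX' k p.1) ∘ (liftEquiv (τ' μ) ι).symm))
    (hhddf : ∀ k μ, mulOp (fun p : X' × ι => χX' k p.1) ∘ₗ mulOp (fgrad η'⁻¹ (liftEquiv (τ' μ) ι) (fun p : X' × ι => hX' k p.1)) = mulOp (fgrad η'⁻¹ (liftEquiv (τ' μ) ι) (fun p : X' × ι => hX' k p.1)))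
    (hhddbf : ∀ k μ, mulOp (fun p : X' × ι => χX' k p.1) ∘ₗ mulOp (bgrad η'⁻¹ (liftEquiv (τ' μ) ι) (fun p : X' × ι => hX' k p.1)) = mulOp (bgrad η'⁻¹ (liftEquiv (τ' μ) ι) (fun p : X' × ι => hX' k p.1)))
    -- THE TWISTED TRANSPORT (n15-c∕331 §5, dag-n15-a `ctauS_gauge`): per cube `T` factors through `Ad(u′_k)`, the INDUCED coarse gauge `Ad(u′_k∘σ)` and the stair field `S_k`; globally `T = M_{Ψᵀ}∘pull`, `|Ψᵀ| ≤ 1`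
    (hTk : ∀ k, T = mmulOp (fun x' => (coordMat e (ContinuousLinearMap.mulLeftRight ℝ (Matrix m m ℂ) (u' k x') (u' k x')ᴴ))ᵀ) ∘ₗ (mmulOp (fun x' => (St k x')ᵀ) ∘ₗ pull (liftMap π ι)) ∘ₗ mmulOp (fun x => coordMat e (ContinuousLinearMap.mulLeftRight ℝ (Matrix m m ℂ) (u' k (sec x)) (u' k (sec x))ᴴ)))
    (hT0 : T = mmulOp (fun x' => (Ψ x')ᵀ) ∘ₗ pull (liftMap π ι)) (hΨ : ∀ x' i j, |(Ψ x')ᵀ i j| ≤ 1) (hs0 : 0 ≤ s)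
    -- the coarse OUTPUT supports `ψᵒ_k` (cut `χ_k`, partition `h_k`, the commutator piece of the conjugated GLOBAL operator displayed) and the SMEARED stair letters on the fine plateau `ψ′_k` and on `ψᵒ_k∘π`
    (hψoχ : ∀ k, mulOp (fun p : X × ι => ψo k p.1) ∘ₗ mulOp (fun p : X × ι => χX k p.1) = mulOp (fun p : X × ι => χX k p.1))
    (hψoh : ∀ k, mulOp (fun p : X × ι => ψo k p.1) ∘ₗ mulOp (fun p : X × ι => hX k p.1) = mulOp (fun p : X × ι => hX k p.1))
    (hKout : ∀ k, mulOp (fun p : X × ι => ψo k p.1) ∘ₗ (commOp (mmulOp (fun x => coordMat e (ContinuousLinearMap.mulLeftRight ℝ (Matrix m m ℂ) (u' k (sec x)) (u' k (sec x))ᴴ)) ∘ₗ (covLapM τ η (gaugePair τ (fun μ x => coordMat e (ContinuousLinearMap.mulLeftRight ℝ (Matrix m m ℂ) (U μ x) (U μ x)ᴴ))) + P) ∘ₗ mmulOp (fun x => (coordMat e (ContinuousLinearMap.mulLeftRight ℝ (Matrix m m ℂ) (u' k (sec x)) (u' k (sec x))ᴴ))ᵀ)) (fun p : X × ι => hX k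 p.1) ∘ₗ (projO none ∘ₗ bgPropV (stack (mulOp (fun p : X × ι => χtX k p.1) ∘ₗ N k) (fun j => Sum.elim (fun μ => fgrad η⁻¹ (liftEquiv (τ μ) ι)) (fun μ => bgrad η⁻¹ (liftEquiv (τ μ) ι)) j ∘ₗ (mulOp (fun p : X × ι => χtX k p.1) ∘ₗ N k))) (mulOp (fun p : X × ι => ψX k p.1) ∘ₗ (unstackM (tCoefC η (gaugePair τ fun μ x => coordMat e (ContinuousLinearMap.mulLeftRight ℝ (Matrix m m ℂ) (u' k (sec x) * U μ x * (u' k (sec (τ μ x)))ᴴ) (u' k (sec x) * U μ x * (u' k (sec (τ μ x)))ᴴ)ᴴ)))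
            (tCoefA η (gaugePair τ fun μ x => coordMat e (ContinuousLinearMap.mulLeftRight ℝ (Matrix m m ℂ) (u' k (sec x) * U μ x * (u' k (sec (τ μ x)))ᴴ) (u' k (sec x) * U μ x * (u' k (sec (τ μ x)))ᴴ)ᴴ))) + NV k ∘ₗ projO none) ∘ₗ mulOp (fun q : (X × ι) × Option (J ⊕ J) => χX k q.1.1)))) =
      commOp (mmulOp (fun x => coordMat e (ContinuousLinearMap.mulLeftRight ℝ (Matrix m m ℂ) (u' k (sec x)) (u' k (sec x))ᴴ)) ∘ₗ (covLapM τ η (gaugePair τ (fun μ x => coordMat e (ContinuousLinearMap.mulLeftRight ℝ (Matrix m m ℂ) (U μ x) (U μ x)ᴴ))) + P) ∘ₗ mmulOp (fun x => (coordMat e (ContinuousLinearMap.mulLeftRight ℝ (Matrix m m ℂ) (u' k (sec x)) (u' k (sec x))ᴴ))ᵀ)) (fun p : X × ι => hX k p.1) ∘ₗ (projO none ∘ₗ bgPropV (stack (mulOp (fun p : X × ι => χtX k p.1) ∘ₗ N k) (fun j => Sum.elim (fun μ => fgrad η⁻¹ (liftEquiv (τ μ) ι)) (fun μ => bgrad η⁻¹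 (liftEquiv (τ μ) ι)) j ∘ₗ (mulOp (fun p : X × ι => χtX k p.1) ∘ₗ N k))) (mulOp (fun p : X × ι => ψX k p.1) ∘ₗ (unstackM (tCoefC η (gaugePair τ fun μ x => coordMat e (ContinuousLinearMap.mulLeftRight ℝ (Matrix m m ℂ) (u' k (sec x) * U μ x * (u' k (sec (τ μ x)))ᴴ) (u' k (sec x) * U μ x * (u' k (sec (τ μ x)))ᴴ)ᴴ)))
            (tCoefA η (gaugePair τ fun μ x => coordMat e (ContinuousLinearMap.mulLeftRight ℝ (Matrix m m ℂ) (u' k (sec x) * U μ x * (u' k (sec (τ μ x)))ᴴ) (u' k (sec x) * U μ x * (u' k (sec (τ μ x)))ᴴ)ᴴ))) + NV k ∘ₗ projO none) ∘ₗ mulOp (fun q : (X × ι) × Option (J ⊕ J) => χX k q.1.1))))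
    (hSin : ∀ k x' i, ∑ j, |(ψX' k x' • ((St k x')ᵀ - 1)) i j| ≤ s) (hSout : ∀ k x' i, ∑ j, |(ψo k (π x') • ((St k x')ᵀ - 1)) i j| ≤ s)
    (hq' : Nov * ((Fintype.card ι : ℝ) ^ 2 * ((((Fintype.card J : ℝ) * (c₂ * ((β + (β₁ + ct * β)) * (1 - (β + (β₁ + ct * β)) * (R * cr) * cr)⁻¹) + 2 * (c₁ * ((β + (β₁ + ct * β)) * (1 - (β + (β₁ + ct * β)) * (R * cr) * cr)⁻¹))) + θW + cN * ((β + (β₁ + ct * β)) * (1 - (β + (β₁ + ct * β)) * (R * cr) * cr)⁻¹) * cr)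
          + ((ℓ * (Real.exp 1 * ε)⁻¹ + 2 * (ω + ℓ * d₁)) * R * ((β + (β₁ + ct * β)) * (1 - (β + (β₁ + ct * β)) * (R * cr) * cr)⁻¹) * cr + R * c₁ * ((β + (β₁ + ct * β)) * (1 - (β + (β₁ + ct * β)) * (R * cr) * cr)⁻¹) * cr)) + (θF * (1 * ((β + (β₁ + ct * β)) * (1 - (β + (β₁ + ct * β)) * (R * cr) * cr)⁻¹)) * cr)) + (Fintype.card ι : ℝ) ^ 2 * ((ε₀ * (1 - (β + (β₁ + ct * β)) * (R * cr) * cr)⁻¹) + 0)) * cr < 1) :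
    HasMaj (BlockNorm.ofBlocks g (liftBlk blk ι)) (BlockNorm.ofBlocks g (liftBlk (blk ∘ π) ι))
      (idef T T
        (glueInv (parametrix (fun k (p : X' × ι) => hX' k p.1) (fun k => mmulOp (fun x' => (coordMat e (ContinuousLinearMap.mulLeftRight ℝ (Matrix m m ℂ) (u' k x') (u' k x')ᴴ))ᵀ) ∘ₗ (projO none ∘ₗ bgPropV (stack (mulOp (fun p : X' × ι => χtX' k p.1) ∘ₗ N' k) (fun j => Sum.elim (fun μ => fgrad η'⁻¹ (liftEquiv (τ' μ) ι)) (fun μ => bgrad η'⁻¹ (liftEquiv (τ' μ) ι)) j ∘ₗ (mulOp (fun p : X' × ι => χtX' k p.1) ∘ₗ N' k))) (mulOp (fun p : X' × ι => ψX' k p.1) ∘ₗ (unstackM (tCoefC η' (gaugePair τ' fun μ x' => coordMat e (ContinuousLinearMap.mulLeftRight ℝ (Matrix m m ℂ) (u' k x' * U' μ x' * (u' k (τ' μ x'))ᴴ) (u' k x' * U' μ x' * (u' k (τ' μ x'))ᴴ)ᴴ)))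
            (tCoefA η' (gaugePair τ' fun μ x' => coordMat e (ContinuousLinearMap.mulLeftRight ℝ (Matrix m m ℂ) (u' k x' * U' μ x' * (u' k (τ' μ x'))ᴴ) (u' k x' * U' μ x' * (u' k (τ' μ x'))ᴴ)ᴴ))) + NV' k ∘ₗ projO none) ∘ₗ mulOp (fun q : (X' × ι) × Option (J ⊕ J) => χX' k q.1.1))) ∘ₗ mmulOp (fun x' => coordMat e (ContinuousLinearMap.mulLeftRight ℝ (Matrix m m ℂ) (u' k x') (u' k x')ᴴ))))
          (remainder (covLapM τ' η' (gaugePair τ' (fun μ x' => coordMat e (ContinuousLinearMap.mulLeftRight ℝ (Matrix m m ℂ) (U' μ x') (U' μ x')ᴴ))) + P') (fun k (p : X' × ι) => hX' k p.1) (fun k => mmulOp (fun x' => (coordMat e (ContinuousLinearMap.mulLeftRight ℝ (Matrix m m ℂ) (u' k x') (u' k x')ᴴ))ᵀ) ∘ₗ (projO none ∘ₗ bgPropV (stack (mulOp (fun p : X' × ι => χtX' k p.1) ∘ₗ N' k) (fun j => Sum.elim (fun μ => fgrad η'⁻¹ (liftEquiv (τ' μ) ι)) (fun μ => bgrad η'⁻¹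 (liftEquiv (τ' μ) ι)) j ∘ₗ (mulOp (fun p : X' × ι => χtX' k p.1) ∘ₗ N' k))) (mulOp (fun p : X' × ι => ψX' k p.1) ∘ₗ (unstackM (tCoefC η' (gaugePair τ' fun μ x' => coordMat e (ContinuousLinearMap.mulLeftRight ℝ (Matrix m m ℂ) (u' k x' * U' μ x' * (u' k (τ' μ x'))ᴴ) (u' k x' * U' μ x' * (u' k (τ' μ x'))ᴴ)ᴴ)))
            (tCoefA η' (gaugePair τ' fun μ x' => coordMat e (ContinuousLinearMap.mulLeftRight ℝ (Matrix m m ℂ) (u' k x' * U' μ x' * (u' k (τ' μ x'))ᴴ) (u' k x' * U' μ x' * (u' k (τ' μ x'))ᴴ)ᴴ))) + NV' k ∘ₗ projO none) ∘ₗ mulOp (fun q : (X' × ι) × Option (J ⊕ J) => χX' k q.1.1))) ∘ₗ mmulOp (fun x' => coordMat e (ContinuousLinearMap.mulLeftRight ℝ (Matrix m m ℂ) (u' k x') (u' k x')ᴴ))) -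
            ∑ k, (mmulOp (fun x' => (coordMat e (ContinuousLinearMap.mulLeftRight ℝ (Matrix m m ℂ) (u' k x') (u' k x')ᴴ))ᵀ) ∘ₗ ((((-(mulOp (fun p : X' × ι => hX' k p.1) ∘ₗ NL' ∘ₗ mulOp (1 - fun p : X' × ι => χtX' k p.1))) ∘ₗ N' k) ∘ₗ (LinearMap.id + ((mulOp (fun p : X' × ι => ψX' k p.1) ∘ₗ (unstackM (tCoefC η' (gaugePair τ' fun μ x' => coordMat e (ContinuousLinearMap.mulLeftRight ℝ (Matrix m m ℂ) (u' k x' * U' μ x' * (u' k (τ' μ x'))ᴴ) (u' k x' * U' μ x' * (u' k (τ' μ x'))ᴴ)ᴴ)))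
            (tCoefA η' (gaugePair τ' fun μ x' => coordMat e (ContinuousLinearMap.mulLeftRight ℝ (Matrix m m ℂ) (u' k x' * U' μ x' * (u' k (τ' μ x'))ᴴ) (u' k x' * U' μ x' * (u' k (τ' μ x'))ᴴ)ᴴ))) + NV' k ∘ₗ projO none) ∘ₗ mulOp (fun q : (X' × ι) × Option (J ⊕ J) => χX' k q.1.1)) ∘ₗ stack LinearMap.id (fun j => Sum.elim (fun μ => fgrad η'⁻¹ (liftEquiv (τ' μ) ι)) (fun μ => bgrad η'⁻¹ (liftEquiv (τ' μ) ι)) j)) ∘ₗ (projO none ∘ₗ bgPropV (stack (mulOp (fun p : X' × ι => χtX' k p.1) ∘ₗ N' k) (fun j => Sum.elim (fun μ => fgrad η'⁻¹ (liftEquiv (τ' μ) ι)) (fun μ => bgrad η'⁻¹ (liftEquiv (τ' μ) ι)) j ∘ₗ (mulOp (fun p : X' × ι => χtX' k p.1) ∘ₗ N' k))) (mulOp (fun p : X' × ι => ψX' k p.1) ∘ₗ (unstackM (tCoefC η' (gaugePair τ' fun μ x' => coordMat e (ContinuousLinearMap.mulLeftRight ℝ (Matrix m m ℂ) (u' k x'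 * U' μ x' * (u' k (τ' μ x'))ᴴ) (u' k x' * U' μ x' * (u' k (τ' μ x'))ᴴ)ᴴ)))
            (tCoefA η' (gaugePair τ' fun μ x' => coordMat e (ContinuousLinearMap.mulLeftRight ℝ (Matrix m m ℂ) (u' k x' * U' μ x' * (u' k (τ' μ x'))ᴴ) (u' k x' * U' μ x' * (u' k (τ' μ x'))ᴴ)ᴴ))) + NV' k ∘ₗ projO none) ∘ₗ mulOp (fun q : (X' × ι) × Option (J ⊕ J) => χX' k q.1.1)))) + mulOp (fun p : X' × ι => hX' k p.1) ∘ₗ (-(((unstackM (tCoefC η' (gaugePair τ' fun μ x' => coordMat e (ContinuousLinearMap.mulLeftRight ℝ (Matrix m m ℂ) (u' k x' * U' μ x' * (u' k (τ' μ x'))ᴴ) (u' k x' * U' μ x' * (u' k (τ' μ x'))ᴴ)ᴴ)))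
            (tCoefA η' (gaugePair τ' fun μ x' => coordMat e (ContinuousLinearMap.mulLeftRight ℝ (Matrix m m ℂ) (u' k x' * U' μ x' * (u' k (τ' μ x'))ᴴ) (u' k x' * U' μ x' * (u' k (τ' μ x'))ᴴ)ᴴ))) + NV' k ∘ₗ projO none) - mulOp (fun p : X' × ι => ψX' k p.1) ∘ₗ (unstackM (tCoefC η' (gaugePair τ' fun μ x' => coordMat e (ContinuousLinearMap.mulLeftRight ℝ (Matrix m m ℂ) (u' k x' * U' μ x' * (u' k (τ' μ x'))ᴴ) (u' k x' * U' μ x' * (u' k (τ' μ x'))ᴴ)ᴴ)))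
            (tCoefA η' (gaugePair τ' fun μ x' => coordMat e (ContinuousLinearMap.mulLeftRight ℝ (Matrix m m ℂ) (u' k x' * U' μ x' * (u' k (τ' μ x'))ᴴ) (u' k x' * U' μ x' * (u' k (τ' μ x'))ᴴ)ᴴ))) + NV' k ∘ₗ projO none) ∘ₗ mulOp (fun q : (X' × ι) × Option (J ⊕ J) => χX' k q.1.1)) ∘ₗ stack LinearMap.id (fun j => Sum.elim (fun μ => fgrad η'⁻¹ (liftEquiv (τ' μ) ι)) (fun μ => bgrad η'⁻¹ (liftEquiv (τ' μ) ι)) j))) ∘ₗ (projO none ∘ₗ bgPropV (stack (mulOp (fun p : X' × ι => χtX' k p.1) ∘ₗ N' k) (fun j => Sum.elim (fun μ => fgrad η'⁻¹ (liftEquiv (τ' μ) ι)) (fun μ => bgrad η'⁻¹ (liftEquiv (τ' μ) ι)) j ∘ₗ (mulOp (fun p : X' × ι => χtX' k p.1) ∘ₗ N' k))) (mulOp (fun p : X' × ι => ψX' k p.1) ∘ₗ (unstackM (tCoefC η' (gaugePair τ' fun μ x' => coordMat e (ContinuousLinearMap.mulLeftRight ℝ (Matrix m m ℂ) (u' k x'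 * U' μ x' * (u' k (τ' μ x'))ᴴ) (u' k x' * U' μ x' * (u' k (τ' μ x'))ᴴ)ᴴ)))
            (tCoefA η' (gaugePair τ' fun μ x' => coordMat e (ContinuousLinearMap.mulLeftRight ℝ (Matrix m m ℂ) (u' k x' * U' μ x' * (u' k (τ' μ x'))ᴴ) (u' k x' * U' μ x' * (u' k (τ' μ x'))ᴴ)ᴴ))) + NV' k ∘ₗ projO none) ∘ₗ mulOp (fun q : (X' × ι) × Option (J ⊕ J) => χX' k q.1.1))))) ∘ₗ mmulOp (fun x' => coordMat e (ContinuousLinearMap.mulLeftRight ℝ (Matrix m m ℂ) (u' k x') (u' k x')ᴴ))) ∘ₗ mulOp (fun p : X' × ι => hX' k p.1)))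
        (glueInv (parametrix (fun k (p : X × ι) => hX k p.1) (fun k => mmulOp (fun x => (coordMat e (ContinuousLinearMap.mulLeftRight ℝ (Matrix m m ℂ) (u' k (sec x)) (u' k (sec x))ᴴ))ᵀ) ∘ₗ (projO none ∘ₗ bgPropV (stack (mulOp (fun p : X × ι => χtX k p.1) ∘ₗ N k) (fun j => Sum.elim (fun μ => fgrad η⁻¹ (liftEquiv (τ μ) ι)) (fun μ => bgrad η⁻¹ (liftEquiv (τ μ) ι)) j ∘ₗ (mulOp (fun p : X × ι => χtX k p.1) ∘ₗ N k))) (mulOp (fun p : X × ι => ψX k p.1) ∘ₗ (unstackM (tCoefC η (gaugePair τ fun μ x => coordMat e (ContinuousLinearMap.mulLeftRight ℝ (Matrix m m ℂ) (u' k (sec x) * U μ x * (u' k (sec (τ μ x)))ᴴ) (u' k (sec x) * U μ x * (u' k (sec (τ μ x)))ᴴ)ᴴ)))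
            (tCoefA η (gaugePair τ fun μ x => coordMat e (ContinuousLinearMap.mulLeftRight ℝ (Matrix m m ℂ) (u' k (sec x) * U μ x * (u' k (sec (τ μ x)))ᴴ) (u' k (sec x) * U μ x * (u' k (sec (τ μ x)))ᴴ)ᴴ))) + NV k ∘ₗ projO none) ∘ₗ mulOp (fun q : (X × ι) × Option (J ⊕ J) => χX k q.1.1))) ∘ₗ mmulOp (fun x => coordMat e (ContinuousLinearMap.mulLeftRight ℝ (Matrix m m ℂ) (u' k (sec x)) (u' k (sec x))ᴴ))))
          (remainder (covLapM τ η (gaugePair τ (fun μ x => coordMat e (ContinuousLinearMap.mulLeftRight ℝ (Matrix m m ℂ) (U μ x) (U μ x)ᴴ))) + P) (fun k (p : X × ι) => hX k p.1) (fun k => mmulOp (fun x => (coordMat e (ContinuousLinearMap.mulLeftRight ℝ (Matrix m m ℂ) (u' k (sec x)) (u' k (sec x))ᴴ))ᵀ) ∘ₗ (projO none ∘ₗ bgPropV (stack (mulOp (fun p : X × ι => χtX k p.1) ∘ₗ N k) (fun j => Sum.elim (fun μ => fgrad η⁻¹ (liftEquiv (τ μ) ι)) (fun μ => bgrad η⁻¹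 (liftEquiv (τ μ) ι)) j ∘ₗ (mulOp (fun p : X × ι => χtX k p.1) ∘ₗ N k))) (mulOp (fun p : X × ι => ψX k p.1) ∘ₗ (unstackM (tCoefC η (gaugePair τ fun μ x => coordMat e (ContinuousLinearMap.mulLeftRight ℝ (Matrix m m ℂ) (u' k (sec x) * U μ x * (u' k (sec (τ μ x)))ᴴ) (u' k (sec x) * U μ x * (u' k (sec (τ μ x)))ᴴ)ᴴ)))
            (tCoefA η (gaugePair τ fun μ x => coordMat e (ContinuousLinearMap.mulLeftRight ℝ (Matrix m m ℂ) (u' k (sec x) * U μ x * (u' k (sec (τ μ x)))ᴴ) (u' k (sec x) * U μ x * (u' k (sec (τ μ x)))ᴴ)ᴴ))) + NV k ∘ₗ projO none) ∘ₗ mulOp (fun q : (X × ι) × Option (J ⊕ J) => χX k q.1.1))) ∘ₗ mmulOp (fun x => coordMat e (ContinuousLinearMap.mulLeftRight ℝ (Matrix m m ℂ) (u' k (sec x)) (u' k (sec x))ᴴ))) -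
            ∑ k, (mmulOp (fun x => (coordMat e (ContinuousLinearMap.mulLeftRight ℝ (Matrix m m ℂ) (u' k (sec x)) (u' k (sec x))ᴴ))ᵀ) ∘ₗ ((((-(mulOp (fun p : X × ι => hX k p.1) ∘ₗ NL ∘ₗ mulOp (1 - fun p : X × ι => χtX k p.1))) ∘ₗ N k) ∘ₗ (LinearMap.id + ((mulOp (fun p : X × ι => ψX k p.1) ∘ₗ (unstackM (tCoefC η (gaugePair τ fun μ x => coordMat e (ContinuousLinearMap.mulLeftRight ℝ (Matrix m m ℂ) (u' k (sec x) * U μ x * (u' k (sec (τ μ x)))ᴴ) (u' k (sec x) * U μ x * (u' k (sec (τ μ x)))ᴴ)ᴴ)))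
            (tCoefA η (gaugePair τ fun μ x => coordMat e (ContinuousLinearMap.mulLeftRight ℝ (Matrix m m ℂ) (u' k (sec x) * U μ x * (u' k (sec (τ μ x)))ᴴ) (u' k (sec x) * U μ x * (u' k (sec (τ μ x)))ᴴ)ᴴ))) + NV k ∘ₗ projO none) ∘ₗ mulOp (fun q : (X × ι) × Option (J ⊕ J) => χX k q.1.1)) ∘ₗ stack LinearMap.id (fun j => Sum.elim (fun μ => fgrad η⁻¹ (liftEquiv (τ μ) ι)) (fun μ => bgrad η⁻¹ (liftEquiv (τ μ) ι)) j)) ∘ₗ (projO none ∘ₗ bgPropV (stack (mulOp (fun p : X × ι => χtX k p.1) ∘ₗ N k) (fun j => Sum.elim (fun μ => fgrad η⁻¹ (liftEquiv (τ μ) ι)) (fun μ => bgrad η⁻¹ (liftEquiv (τ μ) ι)) j ∘ₗ (mulOp (fun p : X × ι => χtX k p.1) ∘ₗ N k))) (mulOp (fun p : X × ι => ψX k p.1) ∘ₗ (unstackM (tCoefC η (gaugePair τ fun μ x => coordMat e (ContinuousLinearMap.mulLeftRight ℝ (Matrix m m ℂ) (u' k (sec x) * U μ x * (u' k (sec (τ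 μ x)))ᴴ) (u' k (sec x) * U μ x * (u' k (sec (τ μ x)))ᴴ)ᴴ)))
            (tCoefA η (gaugePair τ fun μ x => coordMat e (ContinuousLinearMap.mulLeftRight ℝ (Matrix m m ℂ) (u' k (sec x) * U μ x * (u' k (sec (τ μ x)))ᴴ) (u' k (sec x) * U μ x * (u' k (sec (τ μ x)))ᴴ)ᴴ))) + NV k ∘ₗ projO none) ∘ₗ mulOp (fun q : (X × ι) × Option (J ⊕ J) => χX k q.1.1)))) + mulOp (fun p : X × ι => hX k p.1) ∘ₗ (-(((unstackM (tCoefC η (gaugePair τ fun μ x => coordMat e (ContinuousLinearMap.mulLeftRight ℝ (Matrix m m ℂ) (u' k (sec x) * U μ x * (u' k (sec (τ μ x)))ᴴ) (u' k (sec x) * U μ x * (u' k (sec (τ μ x)))ᴴ)ᴴ)))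
            (tCoefA η (gaugePair τ fun μ x => coordMat e (ContinuousLinearMap.mulLeftRight ℝ (Matrix m m ℂ) (u' k (sec x) * U μ x * (u' k (sec (τ μ x)))ᴴ) (u' k (sec x) * U μ x * (u' k (sec (τ μ x)))ᴴ)ᴴ))) + NV k ∘ₗ projO none) - mulOp (fun p : X × ι => ψX k p.1) ∘ₗ (unstackM (tCoefC η (gaugePair τ fun μ x => coordMat e (ContinuousLinearMap.mulLeftRight ℝ (Matrix m m ℂ) (u' k (sec x) * U μ x * (u' k (sec (τ μ x)))ᴴ) (u' k (sec x) * U μ x * (u' k (sec (τ μ x)))ᴴ)ᴴ)))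
            (tCoefA η (gaugePair τ fun μ x => coordMat e (ContinuousLinearMap.mulLeftRight ℝ (Matrix m m ℂ) (u' k (sec x) * U μ x * (u' k (sec (τ μ x)))ᴴ) (u' k (sec x) * U μ x * (u' k (sec (τ μ x)))ᴴ)ᴴ))) + NV k ∘ₗ projO none) ∘ₗ mulOp (fun q : (X × ι) × Option (J ⊕ J) => χX k q.1.1)) ∘ₗ stack LinearMap.id (fun j => Sum.elim (fun μ => fgrad η⁻¹ (liftEquiv (τ μ) ι)) (fun μ => bgrad η⁻¹ (liftEquiv (τ μ) ι)) j))) ∘ₗ (projO none ∘ₗ bgPropV (stack (mulOp (fun p : X × ι => χtX k p.1) ∘ₗ N k) (fun j => Sum.elim (fun μ => fgrad η⁻¹ (liftEquiv (τ μ) ι)) (fun μ => bgrad η⁻¹ (liftEquiv (τ μ) ι)) j ∘ₗ (mulOp (fun p : X × ι => χtX k p.1) ∘ₗ N k))) (mulOp (fun p : X × ι => ψX k p.1) ∘ₗ (unstackM (tCoefC η (gaugePair τ fun μ x => coordMat e (ContinuousLinearMap.mulLeftRight ℝ (Matrix m m ℂ) (u' k (sec x) * U μ x * (u' k (sec (τ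 μ x)))ᴴ) (u' k (sec x) * U μ x * (u' k (sec (τ μ x)))ᴴ)ᴴ)))
            (tCoefA η (gaugePair τ fun μ x => coordMat e (ContinuousLinearMap.mulLeftRight ℝ (Matrix m m ℂ) (u' k (sec x) * U μ x * (u' k (sec (τ μ x)))ᴴ) (u' k (sec x) * U μ x * (u' k (sec (τ μ x)))ᴴ)ᴴ))) + NV k ∘ₗ projO none) ∘ₗ mulOp (fun q : (X × ι) × Option (J ⊕ J) => χX k q.1.1))))) ∘ₗ mmulOp (fun x => coordMat e (ContinuousLinearMap.mulLeftRight ℝ (Matrix m m ℂ) (u' k (sec x)) (u' k (sec x))ᴴ))) ∘ₗ mulOp (fun p : X × ι => hX k p.1))))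
      (fun y y' => (Nov * ((Fintype.card ι : ℝ) ^ 2 * ((β + (β₁ + ct * β)) * (1 - (β + (β₁ + ct * β)) * (R * cr) * cr)⁻¹)) * ((1 - Nov * (((Fintype.card ι : ℝ) ^ 2 * (((((Fintype.card J : ℝ) * (c₂ * ((β + (β₁ + ct * β)) * (1 - (β + (β₁ + ct * β)) * (R * cr) * cr)⁻¹) + 2 * (c₁ * ((β + (β₁ + ct * β)) * (1 - (β + (β₁ + ct * β)) * (R * cr) * cr)⁻¹))) + θW + cN * ((β + (β₁ + ct * β)) * (1 - (β + (β₁ + ct * β)) * (R * cr) * cr)⁻¹) * cr)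
          + ((ℓ * (Real.exp 1 * ε)⁻¹ + 2 * (ω + ℓ * d₁)) * R * ((β + (β₁ + ct * β)) * (1 - (β + (β₁ + ct * β)) * (R * cr) * cr)⁻¹) * cr + R * c₁ * ((β + (β₁ + ct * β)) * (1 - (β + (β₁ + ct * β)) * (R * cr) * cr)⁻¹) * cr)) + (θF * (1 * ((β + (β₁ + ct * β)) * (1 - (β + (β₁ + ct * β)) * (R * cr) * cr)⁻¹)) * cr)))) + ((Fintype.card ι : ℝ) ^ 2 * ((ε₀ * (1 - (β + (β₁ + ct * β)) * (R * cr) * cr)⁻¹) + 0))) * cr)⁻¹ * ((1 - Nov * (((Fintype.card ι : ℝ) ^ 2 * (((((Fintype.card J : ℝ) * (c₂ * ((β + (β₁ + ct * β)) * (1 - (β + (β₁ + ct * β)) * (R * cr) * cr)⁻¹) + 2 * (c₁ * ((β + (β₁ + ct * β)) * (1 - (β + (β₁ + ct * β)) * (R * cr) * cr)⁻¹))) + θW + cN * ((β + (β₁ + ct * β)) * (1 - (β + (β₁ + ct * β)) * (R * cr) * cr)⁻¹) * cr)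
          + ((ℓ * (Real.exp 1 * ε)⁻¹ + 2 * (ω + ℓ * d₁)) * R * ((β + (β₁ + ct * β)) * (1 - (β + (β₁ + ct * β)) * (R * cr) * cr)⁻¹) * cr + R * c₁ * ((β + (β₁ + ct * β)) * (1 - (β + (β₁ + ct * β)) * (R * cr) * cr)⁻¹) * cr)) + (θF * (1 * ((β + (β₁ + ct * β)) * (1 - (β + (β₁ + ct * β)) * (R * cr) * cr)⁻¹)) * cr)))) + ((Fintype.card ι : ℝ) ^ 2 * ((ε₀ * (1 - (β + (β₁ + ct * β)) * (R * cr) * cr)⁻¹) + 0))) * cr)⁻¹ * (Nov * (((Fintype.card ι : ℝ) ^ 2 * (((((Fintype.card J : ℝ) * (c₂ * ((β + (β₁ + ct * β)) * (1 - (β + (β₁ + ct * β)) * (R * cr) * cr)⁻¹) + 2 * (c₁ * ((β + (β₁ + ct * β)) * (1 - (β + (β₁ + ct * β)) * (R * cr) * cr)⁻¹))) + θW + cN * ((β + (β₁ + ct * β)) * (1 - (β + (β₁ + ct * β)) * (R * cr) * cr)⁻¹) * cr)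
          + ((ℓ * (Real.exp 1 * ε)⁻¹ + 2 * (ω + ℓ * d₁)) * R * ((β + (β₁ + ct * β)) * (1 - (β + (β₁ + ct * β)) * (R * cr) * cr)⁻¹) * cr + R * c₁ * ((β + (β₁ + ct * β)) * (1 - (β + (β₁ + ct * β)) * (R * cr) * cr)⁻¹) * cr)) + (θF * (1 * ((β + (β₁ + ct * β)) * (1 - (β + (β₁ + ct * β)) * (R * cr) * cr)⁻¹)) * cr)))) * ((Fintype.card ι : ℝ) * oo) + ((Fintype.card ι : ℝ) ^ 2 * ((((((Fintype.card J * (c₂ * ((((m₀ + oχ * β) + (m₁ + oχ₁ * β₁ + ct * m₀ + oχ₂ * β)) * cr + 1 * (((m₀ + oχ * β) + (m₁ + oχ₁ * β₁ + ct * m₀ + oχ₂ * β)) * cr) * (R * ((β + (β₁ + ct * β)) * (1 - (β + (β₁ + ct * β)) * (R * cr) * cr)⁻¹) * cr) + (β + (β₁ + ct * β)) * o * cr * ((β + (β₁ + ct * β)) * (1 - (β + (β₁ + ct * β)) * (R * cr) * cr)⁻¹) * cr) * (1 - 1 * ((β + (β₁ + ct * β)) * (R * cr) * cr))⁻¹)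
              + o₂ * ((β + (β₁ + ct * β)) * (1 - (β + (β₁ + ct * β)) * (R * cr) * cr)⁻¹)
              + 2 * (c₁ * ((((m₀ + oχ * β) + (m₁ + oχ₁ * β₁ + ct * m₀ + oχ₂ * β)) * cr + 1 * (((m₀ + oχ * β) + (m₁ + oχ₁ * β₁ + ct * m₀ + oχ₂ * β)) * cr) * (R * ((β + (β₁ + ct * β)) * (1 - (β + (β₁ + ct * β)) * (R * cr) * cr)⁻¹) * cr) + (β + (β₁ + ct * β)) * o * cr * ((β + (β₁ + ct * β)) * (1 - (β + (β₁ + ct * β)) * (R * cr) * cr)⁻¹) * cr) * (1 - 1 * ((β + (β₁ + ct * β)) * (R * cr) * cr))⁻¹)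
                + o₁ * ((β + (β₁ + ct * β)) * (1 - (β + (β₁ + ct * β)) * (R * cr) * cr)⁻¹))) + rW)
          + (cN * ((((m₀ + oχ * β) + (m₁ + oχ₁ * β₁ + ct * m₀ + oχ₂ * β)) * cr + 1 * (((m₀ + oχ * β) + (m₁ + oχ₁ * β₁ + ct * m₀ + oχ₂ * β)) * cr) * (R * ((β + (β₁ + ct * β)) * (1 - (β + (β₁ + ct * β)) * (R * cr) * cr)⁻¹) * cr) + (β + (β₁ + ct * β)) * o * cr * ((β + (β₁ + ct * β)) * (1 - (β + (β₁ + ct * β)) * (R * cr) * cr)⁻¹) * cr) * (1 - 1 * ((β + (β₁ + ct * β)) * (R * cr) * cr))⁻¹) * cr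
              + rN * ((β + (β₁ + ct * β)) * (1 - (β + (β₁ + ct * β)) * (R * cr) * cr)⁻¹) * cr)
          + ((((ℓ * (Real.exp 1 * ε)⁻¹ + 2 * (ω + ℓ * d₁)) * R)
                * ((((m₀ + oχ * β) + (m₁ + oχ₁ * β₁ + ct * m₀ + oχ₂ * β)) * cr + 1 * (((m₀ + oχ * β) + (m₁ + oχ₁ * β₁ + ct * m₀ + oχ₂ * β)) * cr) * (R * ((β + (β₁ + ct * β)) * (1 - (β + (β₁ + ct * β)) * (R * cr) * cr)⁻¹) * cr) + (β + (β₁ + ct * β)) * o * cr * ((β + (β₁ + ct * β)) * (1 - (β + (β₁ + ct * β)) * (R * cr) * cr)⁻¹) * cr) * (1 - 1 * ((β + (β₁ + ct * β)) * (R * cr) * cr))⁻¹)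
              + ((ℓ * (Real.exp 1 * ε)⁻¹ + 2 * (ω + ℓ * d₁)) * o + 2 * R * (oo + c₁ / η'⁻¹ + c₁ / η⁻¹))
                * ((β + (β₁ + ct * β)) * (1 - (β + (β₁ + ct * β)) * (R * cr) * cr)⁻¹)
              + R * (c₁ * ((((m₀ + oχ * β) + (m₁ + oχ₁ * β₁ + ct * m₀ + oχ₂ * β)) * cr + 1 * (((m₀ + oχ * β) + (m₁ + oχ₁ * β₁ + ct * m₀ + oχ₂ * β)) * cr) * (R * ((β + (β₁ + ct * β)) * (1 - (β + (β₁ + ct * β)) * (R * cr) * cr)⁻¹) * cr) + (β + (β₁ + ct * β)) * o * cr * ((β + (β₁ + ct * β)) * (1 - (β + (β₁ + ct * β)) * (R * cr) * cr)⁻¹) * cr) * (1 - 1 * ((β + (β₁ + ct * β)) * (R * cr) * cr))⁻¹)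
                + o₁ * ((β + (β₁ + ct * β)) * (1 - (β + (β₁ + ct * β)) * (R * cr) * cr)⁻¹))
              + o * c₁ * ((β + (β₁ + ct * β)) * (1 - (β + (β₁ + ct * β)) * (R * cr) * cr)⁻¹)) * cr))) + (θF * (1 * ((((m₀ + oχ * β) + (m₁ + oχ₁ * β₁ + ct * m₀ + oχ₂ * β)) * cr +
              1 * (((m₀ + oχ * β) + (m₁ + oχ₁ * β₁ + ct * m₀ + oχ₂ * β)) * cr) * (R * ((β + (β₁ + ct * β)) * (1 - (β + (β₁ + ct * β)) * (R * cr) * cr)⁻¹) * cr) +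
            (β + (β₁ + ct * β)) * o * cr * ((β + (β₁ + ct * β)) * (1 - (β + (β₁ + ct * β)) * (R * cr) * cr)⁻¹) * cr) *
          (1 - 1 * ((β + (β₁ + ct * β)) * (R * cr) * cr))⁻¹) + (1 * ((β + (β₁ + ct * β)) * (1 - (β + (β₁ + ct * β)) * (R * cr) * cr)⁻¹)) * oo) * cr + rD * (1 * ((β + (β₁ + ct * β)) * (1 - (β + (β₁ + ct * β)) * (R * cr) * cr)⁻¹)) * cr))) + s * (((((Fintype.card J : ℝ) * (c₂ * ((β + (β₁ + ct * β)) * (1 - (β + (β₁ + ct * β)) * (R * cr) * cr)⁻¹) + 2 * (c₁ * ((β + (β₁ + ct * β)) * (1 - (β + (β₁ + ct * β)) * (R * cr) * cr)⁻¹))) + θW + cN * ((β + (β₁ + ct * β)) * (1 - (β + (β₁ + ct * β)) * (R * cr) * cr)⁻¹) * cr)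
          + ((ℓ * (Real.exp 1 * ε)⁻¹ + 2 * (ω + ℓ * d₁)) * R * ((β + (β₁ + ct * β)) * (1 - (β + (β₁ + ct * β)) * (R * cr) * cr)⁻¹) * cr + R * c₁ * ((β + (β₁ + ct * β)) * (1 - (β + (β₁ + ct * β)) * (R * cr) * cr)⁻¹) * cr)) + (θF * (1 * ((β + (β₁ + ct * β)) * (1 - (β + (β₁ + ct * β)) * (R * cr) * cr)⁻¹)) * cr))) + s * (((((Fintype.card J : ℝ) * (c₂ * ((β + (β₁ + ct * β)) * (1 - (β + (β₁ + ct * β)) * (R * cr) * cr)⁻¹) + 2 * (c₁ * ((β + (β₁ + ct * β)) * (1 - (β + (β₁ + ct * β)) * (R * cr) * cr)⁻¹))) + θW + cN * ((β + (β₁ + ct * β)) * (1 - (β + (β₁ + ct * β)) * (R * cr) * cr)⁻¹) * cr)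
          + ((ℓ * (Real.exp 1 * ε)⁻¹ + 2 * (ω + ℓ * d₁)) * R * ((β + (β₁ + ct * β)) * (1 - (β + (β₁ + ct * β)) * (R * cr) * cr)⁻¹) * cr + R * c₁ * ((β + (β₁ + ct * β)) * (1 - (β + (β₁ + ct * β)) * (R * cr) * cr)⁻¹) * cr)) + (θF * (1 * ((β + (β₁ + ct * β)) * (1 - (β + (β₁ + ct * β)) * (R * cr) * cr)⁻¹)) * cr))))) + (((Fintype.card ι : ℝ) ^ 2 * ((ε₀ * (1 - (β + (β₁ + ct * β)) * (R * cr) * cr)⁻¹) + 0)) * ((Fintype.card ι : ℝ) * oo) + ((Fintype.card ι : ℝ) ^ 2 * ((((ε₀ * (R * ((((m₀ + oχ * β) + (m₁ + oχ₁ * β₁ + ct * m₀ + oχ₂ * β)) * cr + 1 * (((m₀ + oχ * β) + (m₁ + oχ₁ * β₁ + ct * m₀ + oχ₂ * β)) * cr) * (R * ((β + (β₁ + ct * β)) * (1 - (β + (β₁ + ct * β)) * (R * cr) * cr)⁻¹) * cr) + (β + (β₁ + ct * β)) * o * cr * ((β + (β₁ + ct * β)) * (1 - (β + (β₁ + ct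 * β)) * (R * cr) * cr)⁻¹) * cr) * (1 - 1 * ((β + (β₁ + ct * β)) * (R * cr) * cr))⁻¹) + o * ((β + (β₁ + ct * β)) * (1 - (β + (β₁ + ct * β)) * (R * cr) * cr)⁻¹)) * cr * cr + rF * (1 + R * ((β + (β₁ + ct * β)) * (1 - (β + (β₁ + ct * β)) * (R * cr) * cr)⁻¹) * cr * cr)) + 0)) + s * ((ε₀ * (1 - (β + (β₁ + ct * β)) * (R * cr) * cr)⁻¹) + 0) + s * ((ε₀ * (1 - (β + (β₁ + ct * β)) * (R * cr) * cr)⁻¹) + 0)))))) * cr) * cr) * cr +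
        Nov * (2 * ((Fintype.card ι : ℝ) ^ 2 * ((β + (β₁ + ct * β)) * (1 - (β + (β₁ + ct * β)) * (R * cr) * cr)⁻¹)) * ((Fintype.card ι : ℝ) * oo) + ((Fintype.card ι : ℝ) ^ 2 * ((((((m₀ + oχ * β) + (m₁ + oχ₁ * β₁ + ct * m₀ + oχ₂ * β)) * cr + 1 * (((m₀ + oχ * β) + (m₁ + oχ₁ * β₁ + ct * m₀ + oχ₂ * β)) * cr) * (R * ((β + (β₁ + ct * β)) * (1 - (β + (β₁ + ct * β)) * (R * cr) * cr)⁻¹) * cr) + (β + (β₁ + ct * β)) * o * cr * ((β + (β₁ + ct * β)) * (1 - (β + (β₁ + ct * β)) * (R * cr) * cr)⁻¹) * cr) * (1 - 1 * ((β + (β₁ + ct * β)) * (R * cr) * cr))⁻¹)) + s * ((β + (β₁ + ct * β)) * (1 - (β + (β₁ + ct * β)) * (R * cr) * cr)⁻¹) + s * ((β + (β₁ + ct * β)) * (1 - (β + (β₁ + ct * β)) * (R * cr) * cr)⁻¹)))) * (1 - Nov * (((Fintype.card ι : ℝ) ^ 2 * (((((Fintype.card J : ℝ) * (c₂ * ((β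 + (β₁ + ct * β)) * (1 - (β + (β₁ + ct * β)) * (R * cr) * cr)⁻¹) + 2 * (c₁ * ((β + (β₁ + ct * β)) * (1 - (β + (β₁ + ct * β)) * (R * cr) * cr)⁻¹))) + θW + cN * ((β + (β₁ + ct * β)) * (1 - (β + (β₁ + ct * β)) * (R * cr) * cr)⁻¹) * cr)
          + ((ℓ * (Real.exp 1 * ε)⁻¹ + 2 * (ω + ℓ * d₁)) * R * ((β + (β₁ + ct * β)) * (1 - (β + (β₁ + ct * β)) * (R * cr) * cr)⁻¹) * cr + R * c₁ * ((β + (β₁ + ct * β)) * (1 - (β + (β₁ + ct * β)) * (R * cr) * cr)⁻¹) * cr)) + (θF * (1 * ((β + (β₁ + ct * β)) * (1 - (β + (β₁ + ct * β)) * (R * cr) * cr)⁻¹)) * cr)))) + ((Fintype.card ι : ℝ) ^ 2 * ((ε₀ * (1 - (β + (β₁ + ct * β)) * (R * cr) * cr)⁻¹) + 0))) * cr)⁻¹ * cr) * Real.exp (-((ρ₃ - 2 * σ) * g.dist y y'))):= by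
  have hβb : 0 ≤ β + (β₁ + ct * β) := by positivity
  have hqi : 0 ≤ (1 - (β + (β₁ + ct * β)) * (R * cr) * cr)⁻¹ := inv_nonneg.2 (by linarith)
  have hq1 : 0 ≤ (1 - 1 * ((β + (β₁ + ct * β)) * (R * cr) * cr))⁻¹ := by rw [one_mul]; exact hqi
  have hB : 0 ≤ ((β + (β₁ + ct * β)) * (1 - (β + (β₁ + ct * β)) * (R * cr) * cr)⁻¹) := mul_nonneg hβb hqi
  have hM : 0 ≤ (m₀ + oχ * β) + (m₁ + oχ₁ * β₁ + ct * m₀ + oχ₂ * β) :=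
    add_nonneg (add_nonneg hm₀ (mul_nonneg hoχ hβ)) (add_nonneg (add_nonneg (add_nonneg hm₁ (mul_nonneg hoχ₁ hβ₁)) (mul_nonneg hct hm₀)) (mul_nonneg hoχ₂ hβ))
  have hAD : 0 ≤ ((((m₀ + oχ * β) + (m₁ + oχ₁ * β₁ + ct * m₀ + oχ₂ * β)) * cr +
              1 * (((m₀ + oχ * β) + (m₁ + oχ₁ * β₁ + ct * m₀ + oχ₂ * β)) * cr) * (R * ((β + (β₁ + ct * β)) * (1 - (β + (β₁ + ct * β)) * (R * cr) * cr)⁻¹) * cr) +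
            (β + (β₁ + ct * β)) * o * cr * ((β + (β₁ + ct * β)) * (1 - (β + (β₁ + ct * β)) * (R * cr) * cr)⁻¹) * cr) *
          (1 - 1 * ((β + (β₁ + ct * β)) * (R * cr) * cr))⁻¹) :=
    mul_nonneg (add_nonneg (add_nonneg (mul_nonneg hM hcr) (mul_nonneg (mul_nonneg zero_le_one (mul_nonneg hM hcr)) (mul_nonneg (mul_nonneg hR hB) hcr)))
      (mul_nonneg (mul_nonneg (mul_nonneg (mul_nonneg hβb ho) hcr) hB) hcr)) hq1
  have hθF' : 0 ≤ (θF * (1 * ((β + (β₁ + ct * β)) * (1 - (β + (β₁ + ct * β)) * (R * cr) * cr)⁻¹)) * cr) := mul_nonneg (mul_nonneg hθF (mul_nonneg zero_le_one hB)) hcr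
  have hrFK' : 0 ≤ (θF * (1 * ((((m₀ + oχ * β) + (m₁ + oχ₁ * β₁ + ct * m₀ + oχ₂ * β)) * cr +
              1 * (((m₀ + oχ * β) + (m₁ + oχ₁ * β₁ + ct * m₀ + oχ₂ * β)) * cr) * (R * ((β + (β₁ + ct * β)) * (1 - (β + (β₁ + ct * β)) * (R * cr) * cr)⁻¹) * cr) +
            (β + (β₁ + ct * β)) * o * cr * ((β + (β₁ + ct * β)) * (1 - (β + (β₁ + ct * β)) * (R * cr) * cr)⁻¹) * cr) *
          (1 - 1 * ((β + (β₁ + ct * β)) * (R * cr) * cr))⁻¹) + (1 * ((β + (β₁ + ct * β)) * (1 - (β + (β₁ + ct * β)) * (R * cr) * cr)⁻¹)) * oo) * cr + rD * (1 * ((β + (β₁ + ct * β)) * (1 - (β + (β₁ + ct * β)) * (R * cr) * cr)⁻¹)) * cr) :=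
    add_nonneg (mul_nonneg (mul_nonneg hθF (add_nonneg (mul_nonneg zero_le_one hAD) (mul_nonneg (mul_nonneg zero_le_one hB) hoo))) hcr) (mul_nonneg (mul_nonneg hrD (mul_nonneg zero_le_one hB)) hcr)
  -- the gauges are orthogonal (dag-n15-w2 `uN_siteGauge_orthogonal`), both grids
  have hugf : ∀ k x', coordMat e (ContinuousLinearMap.mulLeftRight ℝ (Matrix m m ℂ) (u' k x') (u' k x')ᴴ) * (coordMat e (ContinuousLinearMap.mulLeftRight ℝ (Matrix m m ℂ) (u' k x') (u' k x')ᴴ))ᵀ = 1 := fun k x' => (uN_siteGauge_orthogonal e (u' k) he (hu' k) x').1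
  have hugf' : ∀ k x', (coordMat e (ContinuousLinearMap.mulLeftRight ℝ (Matrix m m ℂ) (u' k x') (u' k x')ᴴ))ᵀ * coordMat e (ContinuousLinearMap.mulLeftRight ℝ (Matrix m m ℂ) (u' k x') (u' k x')ᴴ) = 1 := fun k x' => (uN_siteGauge_orthogonal e (u' k) he (hu' k) x').2
  -- the covariance identities (`uN_localOp_eq_cut_add_farDefect` above), both grids
  have hcov := fun k => uN_localOp_eq_cut_add_farDefect τ e (fun x => u' k (sec x)) U (χX k) (ψX k) η he (fun x => hu' k (sec x)) (hP k)
  have hcov' := fun k => uN_localOp_eq_cut_add_farDefect τ' e (u' k) U' (χX' k) (ψX' k) η' he (hu' k) (hP' k)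
  -- the cube perturbations' letters and η-defect (file 51), both grids
  have hV : ∀ k, HasMaj (BlockNorm.ofBlocks g (blkPair (liftBlk blk ι))) (BlockNorm.ofBlocks g (liftBlk blk ι)) (mulOp (fun p : X × ι => ψX k p.1) ∘ₗ (unstackM (tCoefC η (gaugePair τ fun μ x => coordMat e (ContinuousLinearMap.mulLeftRight ℝ (Matrix m m ℂ) (u' k (sec x) * U μ x * (u' k (sec (τ μ x)))ᴴ) (u' k (sec x) * U μ x * (u' k (sec (τ μ x)))ᴴ)ᴴ)))
            (tCoefA η (gaugePair τ fun μ x => coordMat e (ContinuousLinearMap.mulLeftRight ℝ (Matrix m m ℂ) (u' k (sec x) * U μ x * (u' k (sec (τ μ x)))ᴴ) (u' k (sec x) * U μ x * (u' k (sec (τ μ x)))ᴴ)ᴴ))) + NV k ∘ₗ projO none) ∘ₗ mulOp (fun q : (X × ι) × Option (J ⊕ J) => χX k q.1.1)) (fun y y' => R * Real.exp (-(δV * g.dist y y'))) := fun k =>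
    (hasMaj_cutPert_structural_of_local blk hd0 hrV hRN (hχ1 k) (hCloc k) (fun μ x hx => hAloc k μ x hx) (hψχ k) (hNVcut k)).mono fun y y' =>
      mul_le_mul_of_nonneg_right hRle (Real.exp_nonneg _)
  have hV' : ∀ k, HasMaj (BlockNorm.ofBlocks g (blkPair (liftBlk (blk ∘ π) ι))) (BlockNorm.ofBlocks g (liftBlk (blk ∘ π) ι)) (mulOp (fun p : X' × ι => ψX' k p.1) ∘ₗ (unstackM (tCoefC η' (gaugePair τ' fun μ x' => coordMat e (ContinuousLinearMap.mulLeftRight ℝ (Matrix m m ℂ) (u' k x' * U' μ x' * (u' k (τ' μ x'))ᴴ) (u' k x' * U' μ x' * (u' k (τ' μ x'))ᴴ)ᴴ)))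
            (tCoefA η' (gaugePair τ' fun μ x' => coordMat e (ContinuousLinearMap.mulLeftRight ℝ (Matrix m m ℂ) (u' k x' * U' μ x' * (u' k (τ' μ x'))ᴴ) (u' k x' * U' μ x' * (u' k (τ' μ x'))ᴴ)ᴴ))) + NV' k ∘ₗ projO none) ∘ₗ mulOp (fun q : (X' × ι) × Option (J ⊕ J) => χX' k q.1.1)) (fun y y' => R * Real.exp (-(δV * g.dist y y'))) := fun k =>
    (hasMaj_cutPert_structural_of_local (blk ∘ π) hd0 hrV hRN (hχ1' k) (hCloc' k) (fun μ x' hx => hAloc' k μ x' hx) (hψχ' k) (hNVcut' k)).mono fun y y' =>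
      mul_le_mul_of_nonneg_right hRle (Real.exp_nonneg _)
  have hDV : ∀ k, HasMaj (BlockNorm.ofBlocks g (blkPair (liftBlk blk ι))) (BlockNorm.ofBlocks g (liftBlk (blk ∘ π) ι))
      (idef (pull (liftPair (liftMap π ι))) (pull (liftMap π ι)) (mulOp (fun p : X' × ι => ψX' k p.1) ∘ₗ (unstackM (tCoefC η' (gaugePair τ' fun μ x' => coordMat e (ContinuousLinearMap.mulLeftRight ℝ (Matrix m m ℂ) (u' k x' * U' μ x' * (u' k (τ' μ x'))ᴴ) (u' k x' * U' μ x' * (u' k (τ' μ x'))ᴴ)ᴴ)))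
            (tCoefA η' (gaugePair τ' fun μ x' => coordMat e (ContinuousLinearMap.mulLeftRight ℝ (Matrix m m ℂ) (u' k x' * U' μ x' * (u' k (τ' μ x'))ᴴ) (u' k x' * U' μ x' * (u' k (τ' μ x'))ᴴ)ᴴ))) + NV' k ∘ₗ projO none) ∘ₗ mulOp (fun q : (X' × ι) × Option (J ⊕ J) => χX' k q.1.1))
        (mulOp (fun p : X × ι => ψX k p.1) ∘ₗ (unstackM (tCoefC η (gaugePair τ fun μ x => coordMat e (ContinuousLinearMap.mulLeftRight ℝ (Matrix m m ℂ) (u' k (sec x) * U μ x * (u' k (sec (τ μ x)))ᴴ) (u' k (sec x) * U μ x * (u' k (sec (τ μ x)))ᴴ)ᴴ)))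
            (tCoefA η (gaugePair τ fun μ x => coordMat e (ContinuousLinearMap.mulLeftRight ℝ (Matrix m m ℂ) (u' k (sec x) * U μ x * (u' k (sec (τ μ x)))ᴴ) (u' k (sec x) * U μ x * (u' k (sec (τ μ x)))ᴴ)ᴴ))) + NV k ∘ₗ projO none) ∘ₗ mulOp (fun q : (X × ι) × Option (J ⊕ J) => χX k q.1.1))) (fun y y' => o * Real.exp (-(δV * g.dist y y'))) := fun k =>
    (hasMaj_idef_cutPert_structural_of_local blk π hd0 hoV hoN (hψχ k) (hψχ' k) (hfitC k) (fun μ x' i => hfitA k μ x' i) (hDNV k)).mono fun y y' =>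
      mul_le_mul_of_nonneg_right hole (Real.exp_nonneg _)
  -- the `W`-rows vanish (`W = 0 = W′`), both grids and their defect
  have hW : ∀ k, HasMaj (BlockNorm.ofBlocks g (liftBlk blk ι)) (BlockNorm.ofBlocks g (liftBlk blk ι)) (commOp (0 : (X × ι → ℝ) →ₗ[ℝ] (X × ι → ℝ)) (fun p : X × ι => hX k p.1) ∘ₗ (projO none ∘ₗ bgPropV (stack (mulOp (fun p : X × ι => χtX k p.1) ∘ₗ N k)
          (fun j => Sum.elim (fun μ => fgrad η⁻¹ (liftEquiv (τ μ) ι)) (fun μ => bgrad η⁻¹ (liftEquiv (τ μ) ι)) j ∘ₗ (mulOp (fun p : X × ι => χtX k p.1) ∘ₗ N k))) (mulOp (fun p : X × ι => ψX k p.1) ∘ₗ (unstackM (tCoefC η (gaugePair τ fun μ x => coordMat e (ContinuousLinearMap.mulLeftRight ℝ (Matrix m m ℂ) (u' k (sec x) * U μ x * (u' k (sec (τ μ x)))ᴴ) (u' k (sec x) * U μ x * (u' k (sec (τ μ x)))ᴴ)ᴴ)))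
            (tCoefA η (gaugePair τ fun μ x => coordMat e (ContinuousLinearMap.mulLeftRight ℝ (Matrix m m ℂ) (u' k (sec x) * U μ x * (u' k (sec (τ μ x)))ᴴ) (u' k (sec x) * U μ x * (u' k (sec (τ μ x)))ᴴ)ᴴ))) + NV k ∘ₗ projO none) ∘ₗ mulOp (fun q : (X × ι) × Option (J ⊕ J) => χX k q.1.1))))
      (fun y y' => ind (Sk k) y * ind (Sk k) y' * (θW * Real.exp (-(ρ₂ * g.dist y y')))) := fun k => by
    rw [show commOp (0 : (X × ι → ℝ) →ₗ[ℝ] (X × ι → ℝ)) (fun p : X × ι => hX k p.1) = 0 from by simp [commOp], LinearMap.zero_comp]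
    exact (hasMaj_zero _ _).mono fun y y' => mul_nonneg (mul_nonneg (ind_nonneg _ _) (ind_nonneg _ _)) (mul_nonneg hθW (Real.exp_nonneg _))
  have hW' : ∀ k, HasMaj (BlockNorm.ofBlocks g (liftBlk (blk ∘ π) ι)) (BlockNorm.ofBlocks g (liftBlk (blk ∘ π) ι)) (commOp (0 : (X' × ι → ℝ) →ₗ[ℝ] (X' × ι → ℝ)) (fun p : X' × ι => hX' k p.1) ∘ₗ (projO none ∘ₗ bgPropV (stack (mulOp (fun p : X' × ι => χtX' k p.1) ∘ₗ N' k)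
          (fun j => Sum.elim (fun μ => fgrad η'⁻¹ (liftEquiv (τ' μ) ι)) (fun μ => bgrad η'⁻¹ (liftEquiv (τ' μ) ι)) j ∘ₗ (mulOp (fun p : X' × ι => χtX' k p.1) ∘ₗ N' k))) (mulOp (fun p : X' × ι => ψX' k p.1) ∘ₗ (unstackM (tCoefC η' (gaugePair τ' fun μ x' => coordMat e (ContinuousLinearMap.mulLeftRight ℝ (Matrix m m ℂ) (u' k x' * U' μ x' * (u' k (τ' μ x'))ᴴ) (u' k x' * U' μ x' * (u' k (τ' μ x'))ᴴ)ᴴ)))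
            (tCoefA η' (gaugePair τ' fun μ x' => coordMat e (ContinuousLinearMap.mulLeftRight ℝ (Matrix m m ℂ) (u' k x' * U' μ x' * (u' k (τ' μ x'))ᴴ) (u' k x' * U' μ x' * (u' k (τ' μ x'))ᴴ)ᴴ))) + NV' k ∘ₗ projO none) ∘ₗ mulOp (fun q : (X' × ι) × Option (J ⊕ J) => χX' k q.1.1))))
      (fun y y' => ind (Sk k) y * ind (Sk k) y' * (θW * Real.exp (-(ρ₂ * g.dist y y')))) := fun k => by
    rw [show commOp (0 : (X' × ι → ℝ) →ₗ[ℝ] (X' × ι → ℝ)) (fun p : X' × ι => hX' k p.1) = 0 from by simp [commOp], LinearMap.zero_comp]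
    exact (hasMaj_zero _ _).mono fun y y' => mul_nonneg (mul_nonneg (ind_nonneg _ _) (ind_nonneg _ _)) (mul_nonneg hθW (Real.exp_nonneg _))
  have hDW : ∀ k, HasMaj (BlockNorm.ofBlocks g (liftBlk blk ι)) (BlockNorm.ofBlocks g (liftBlk (blk ∘ π) ι))
      (idef (pull (liftMap π ι)) (pull (liftMap π ι)) (commOp (0 : (X' × ι → ℝ) →ₗ[ℝ] (X' × ι → ℝ)) (fun p : X' × ι => hX' k p.1) ∘ₗ (projO none ∘ₗ bgPropV (stack (mulOp (fun p : X' × ι => χtX' k p.1) ∘ₗ N' k)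
          (fun j => Sum.elim (fun μ => fgrad η'⁻¹ (liftEquiv (τ' μ) ι)) (fun μ => bgrad η'⁻¹ (liftEquiv (τ' μ) ι)) j ∘ₗ (mulOp (fun p : X' × ι => χtX' k p.1) ∘ₗ N' k))) (mulOp (fun p : X' × ι => ψX' k p.1) ∘ₗ (unstackM (tCoefC η' (gaugePair τ' fun μ x' => coordMat e (ContinuousLinearMap.mulLeftRight ℝ (Matrix m m ℂ) (u' k x' * U' μ x' * (u' k (τ' μ x'))ᴴ) (u' k x' * U' μ x' * (u' k (τ' μ x'))ᴴ)ᴴ)))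
            (tCoefA η' (gaugePair τ' fun μ x' => coordMat e (ContinuousLinearMap.mulLeftRight ℝ (Matrix m m ℂ) (u' k x' * U' μ x' * (u' k (τ' μ x'))ᴴ) (u' k x' * U' μ x' * (u' k (τ' μ x'))ᴴ)ᴴ))) + NV' k ∘ₗ projO none) ∘ₗ mulOp (fun q : (X' × ι) × Option (J ⊕ J) => χX' k q.1.1))))
        (commOp (0 : (X × ι → ℝ) →ₗ[ℝ] (X × ι → ℝ)) (fun p : X × ι => hX k p.1) ∘ₗ (projO none ∘ₗ bgPropV (stack (mulOp (fun p : X × ι => χtX k p.1) ∘ₗ N k)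
          (fun j => Sum.elim (fun μ => fgrad η⁻¹ (liftEquiv (τ μ) ι)) (fun μ => bgrad η⁻¹ (liftEquiv (τ μ) ι)) j ∘ₗ (mulOp (fun p : X × ι => χtX k p.1) ∘ₗ N k))) (mulOp (fun p : X × ι => ψX k p.1) ∘ₗ (unstackM (tCoefC η (gaugePair τ fun μ x => coordMat e (ContinuousLinearMap.mulLeftRight ℝ (Matrix m m ℂ) (u' k (sec x) * U μ x * (u' k (sec (τ μ x)))ᴴ) (u' k (sec x) * U μ x * (u' k (sec (τ μ x)))ᴴ)ᴴ)))
            (tCoefA η (gaugePair τ fun μ x => coordMat e (ContinuousLinearMap.mulLeftRight ℝ (Matrix m m ℂ) (u' k (sec x) * U μ x * (u' k (sec (τ μ x)))ᴴ) (u' k (sec x) * U μ x * (u' k (sec (τ μ x)))ᴴ)ᴴ))) + NV k ∘ₗ projO none) ∘ₗ mulOp (fun q : (X × ι) × Option (J ⊕ J) => χX k q.1.1)))))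
      (fun y y' => ind (Sk k) y * ind (Sk k) y' * (rW * Real.exp (-(ρ₂ * g.dist y y')))) := fun k =>
    hasMaj_idef_of_eq_zero (pull (liftMap π ι)) (by rw [show commOp (0 : (X' × ι → ℝ) →ₗ[ℝ] (X' × ι → ℝ)) (fun p : X' × ι => hX' k p.1) = 0 from by simp [commOp], LinearMap.zero_comp])
      (by rw [show commOp (0 : (X × ι → ℝ) →ₗ[ℝ] (X × ι → ℝ)) (fun p : X × ι => hX k p.1) = 0 from by simp [commOp], LinearMap.zero_comp])
      fun y y' => mul_nonneg (mul_nonneg (ind_nonneg _ _) (ind_nonneg _ _)) (mul_nonneg hrW (Real.exp_nonneg _))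
  -- the far-defect rows (file 49: `M_hFX = 0`; file 50: `[F, M_h]X` from the far letters) and their η-defects (file 50), both grids
  have hFX := fun k => hasMaj_mulOp_farDefect_smoothCutDressed blk τ η⁻¹ (Vf := (unstackM (tCoefC η (gaugePair τ fun μ x => coordMat e (ContinuousLinearMap.mulLeftRight ℝ (Matrix m m ℂ) (u' k (sec x) * U μ x * (u' k (sec (τ μ x)))ᴴ) (u' k (sec x) * U μ x * (u' k (sec (τ μ x)))ᴴ)ᴴ)))
            (tCoefA η (gaugePair τ fun μ x => coordMat e (ContinuousLinearMap.mulLeftRight ℝ (Matrix m m ℂ) (u' k (sec x) * U μ x * (u' k (sec (τ μ x)))ᴴ) (u' k (sec x) * U μ x * (u' k (sec (τ μ x)))ᴴ)ᴴ))) + NV k ∘ₗ projO none)) htri hd hrow hσ hβ hβ₁ hct hR hcr hσρ hρ₁V hρ₁G hρ₂ hρ₂₁ (hχt k) (hdχt k) (hdχtb k) (hsub k) (hχ k) (hs k)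
    (hsb k) (hdd k) (hddb k) (hs2 k) (hsb2 k) (hdd2 k) (hddb2 k) (hcut k) (hcutF k) (hcutB k) (hV k) hq (hhψ k) ρ₃
  have hFX' := fun k => hasMaj_mulOp_farDefect_smoothCutDressed (blk ∘ π) τ' η'⁻¹ (Vf := (unstackM (tCoefC η' (gaugePair τ' fun μ x' => coordMat e (ContinuousLinearMap.mulLeftRight ℝ (Matrix m m ℂ) (u' k x' * U' μ x' * (u' k (τ' μ x'))ᴴ) (u' k x' * U' μ x' * (u' k (τ' μ x'))ᴴ)ᴴ)))
            (tCoefA η' (gaugePair τ' fun μ x' => coordMat e (ContinuousLinearMap.mulLeftRight ℝ (Matrix m m ℂ) (u' k x' * U' μ x' * (u' k (τ' μ x'))ᴴ) (u' k x' * U' μ x' * (u' k (τ' μ x'))ᴴ)ᴴ))) + NV' k ∘ₗ projO none)) htri hd hrow hσ hβ hβ₁ hct hR hcr hσρ hρ₁V hρ₁G hρ₂ hρ₂₁ (hχt' k) (hdχt' k) (hdχtb' k) (hsub' k)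
    (hχ' k) (hs' k) (hsb' k) (hdd' k) (hddb' k) (hs2' k) (hsb2' k) (hdd2' k) (hddb2' k) (hcut' k) (hcutF' k) (hcutB' k) (hV' k) hq (hhψf k) ρ₃
  have hFK := fun k => hasMaj_commOp_farDefect_structural blk τ η⁻¹ (NV := NV k) (Cc := tCoefC η (gaugePair τ fun μ x => coordMat e (ContinuousLinearMap.mulLeftRight ℝ (Matrix m m ℂ) (u' k (sec x) * U μ x * (u' k (sec (τ μ x)))ᴴ) (u' k (sec x) * U μ x * (u' k (sec (τ μ x)))ᴴ)ᴴ)))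
    (Ac := tCoefA η (gaugePair τ fun μ x => coordMat e (ContinuousLinearMap.mulLeftRight ℝ (Matrix m m ℂ) (u' k (sec x) * U μ x * (u' k (sec (τ μ x)))ᴴ) (u' k (sec x) * U μ x * (u' k (sec (τ μ x)))ᴴ)ᴴ))) htri hd hrow hσ hβ hβ₁ hct hR hcr hσρ hρ₁V hρ₁G hρ₂ hρ₂₁
    (hSχ k) (hSψ k) (hχt k) (hdχt k) (hdχtb k) (hsub k) (hχ k) (hs k) (hsb k) (hdd k) (hddb k) (hs2 k) (hsb2 k) (hdd2 k) (hddb2 k) (hNψ k) (hcut k) (hcutF k) (hcutB k) (hV k) hq hθF hρ₃ hρ₃₂ hρF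
    (hhabs k) (hhψ k) (hχh k) (hhs' k) (hhsb' k) (hhdd' k) (hhddb' k) (hψχ k) (hfarN k)
  have hFK' := fun k => hasMaj_commOp_farDefect_structural (blk ∘ π) τ' η'⁻¹ (NV := NV' k) (Cc := tCoefC η' (gaugePair τ' fun μ x' => coordMat e (ContinuousLinearMap.mulLeftRight ℝ (Matrix m m ℂ) (u' k x' * U' μ x' * (u' k (τ' μ x'))ᴴ) (u' k x' * U' μ x' * (u' k (τ' μ x'))ᴴ)ᴴ)))
    (Ac := tCoefA η' (gaugePair τ' fun μ x' => coordMat e (ContinuousLinearMap.mulLeftRight ℝ (Matrix m m ℂ) (u' k x' * U' μ x' * (u' k (τ' μ x'))ᴴ) (u' k x' * U' μ x' * (u' k (τ' μ x'))ᴴ)ᴴ))) htri hd hrow hσ hβ hβ₁ hct hR hcr hσρ hρ₁V hρ₁G hρ₂ hρ₂₁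
    (hSχ' k) (hSψ' k) (hχt' k) (hdχt' k) (hdχtb' k) (hsub' k) (hχ' k) (hs' k) (hsb' k) (hdd' k) (hddb' k) (hs2' k) (hsb2' k) (hdd2' k) (hddb2' k) (hNψ' k) (hcut' k) (hcutF' k) (hcutB' k) (hV' k) hq
    hθF hρ₃ hρ₃₂ hρF (hhabs' k) (hhψf k) (hχhf k) (hhsf k) (hhsbf k) (hhddf k) (hhddbf k) (hψχ' k) (hfarN' k)
  have hDFK := fun k => hasMaj_idef_commOp_farDefect_structural blk π τ τ' η⁻¹ η'⁻¹ (NV := NV k) (NV' := NV' k) (Cc := tCoefC η (gaugePair τ fun μ x => coordMat e (ContinuousLinearMap.mulLeftRight ℝ (Matrix m m ℂ) (u' k (sec x) * U μ x * (u' k (sec (τ μ x)))ᴴ) (u' k (sec x) * U μ x * (u' k (sec (τ μ x)))ᴴ)ᴴ)))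
    (Ac := tCoefA η (gaugePair τ fun μ x => coordMat e (ContinuousLinearMap.mulLeftRight ℝ (Matrix m m ℂ) (u' k (sec x) * U μ x * (u' k (sec (τ μ x)))ᴴ) (u' k (sec x) * U μ x * (u' k (sec (τ μ x)))ᴴ)ᴴ)))
    (Cc' := tCoefC η' (gaugePair τ' fun μ x' => coordMat e (ContinuousLinearMap.mulLeftRight ℝ (Matrix m m ℂ) (u' k x' * U' μ x' * (u' k (τ' μ x'))ᴴ) (u' k x' * U' μ x' * (u' k (τ' μ x'))ᴴ)ᴴ)))
    (Ac' := tCoefA η' (gaugePair τ' fun μ x' => coordMat e (ContinuousLinearMap.mulLeftRight ℝ (Matrix m m ℂ) (u' k x' * U' μ x' * (u' k (τ' μ x'))ᴴ) (u' k x' * U' μ x' * (u' k (τ' μ x'))ᴴ)ᴴ))) htri hd hrow hσ hcr hβ hβ₁ hct hm₀ hm₁ hoχ hoχ₁ hoχ₂ hR ho hσρ hρ₁V hρ₁G hρ₂ hρ₂₁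
    (hSχ k) (hSψ k) (hSχ' k) (hSψ' k) (hχt k) (hdχt k) (hdχtb k) (hsub k) (hχ k) (hs k) (hsb k) (hdd k) (hddb k) (hNψ k) (hχt' k) (hdχt' k) (hdχtb' k) (hsub' k) (hχ' k) (hs' k) (hsb' k)
    (hdd' k) (hddb' k) (hNψ' k) (hfitχ k) (hfit₁ k) (hfit₁b k) (hfit₂ k) (hfit₂b k) (hcut k) (hcutF k) (hcutB k) (hcut' k) (hcutF' k) (hcutB' k) (hDcut k) (hDcutF k) (hDcutB k) (hV k)
    (hV' k) (hDV k) (hs2 k) (hsb2 k) (hdd2 k) (hddb2 k) (hs2' k) (hsb2' k) (hdd2' k) (hddb2' k) (hhabs k) (hhabs' k) (hfh k) hoo (hhψ k) (hχh k) (hhs' k) (hhsb' k) (hhdd' k) (hhddb' k)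
    (hψχ k) (hhψf k) (hχhf k) (hhsf k) (hhsbf k) (hhddf k) (hhddbf k) (hψχ' k) hθF hrD hρ₃ hρ₃₂ hρF (hfarN' k) (hDfarN k) hq
  have hDFX := fun k => hasMaj_idef_mulOp_farDefect_structural blk π τ τ' η⁻¹ η'⁻¹ (NV := NV k) (NV' := NV' k) (Cc := tCoefC η (gaugePair τ fun μ x => coordMat e (ContinuousLinearMap.mulLeftRight ℝ (Matrix m m ℂ) (u' k (sec x) * U μ x * (u' k (sec (τ μ x)))ᴴ) (u' k (sec x) * U μ x * (u' k (sec (τ μ x)))ᴴ)ᴴ)))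
    (Ac := tCoefA η (gaugePair τ fun μ x => coordMat e (ContinuousLinearMap.mulLeftRight ℝ (Matrix m m ℂ) (u' k (sec x) * U μ x * (u' k (sec (τ μ x)))ᴴ) (u' k (sec x) * U μ x * (u' k (sec (τ μ x)))ᴴ)ᴴ)))
    (Cc' := tCoefC η' (gaugePair τ' fun μ x' => coordMat e (ContinuousLinearMap.mulLeftRight ℝ (Matrix m m ℂ) (u' k x' * U' μ x' * (u' k (τ' μ x'))ᴴ) (u' k x' * U' μ x' * (u' k (τ' μ x'))ᴴ)ᴴ)))
    (Ac' := tCoefA η' (gaugePair τ' fun μ x' => coordMat e (ContinuousLinearMap.mulLeftRight ℝ (Matrix m m ℂ) (u' k x' * U' μ x' * (u' k (τ' μ x'))ᴴ) (u' k x' * U' μ x' * (u' k (τ' μ x'))ᴴ)ᴴ))) htri hd hrow hσ hβ hβ₁ hct hR hcr hσρ hρ₁V hρ₁G hρ₂ hρ₂₁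
    (hχt k) (hdχt k) (hdχtb k) (hsub k) (hχ k) (hs k) (hsb k) (hdd k) (hddb k) (hs2 k) (hsb2 k) (hdd2 k) (hddb2 k) (hcut k) (hcutF k) (hcutB k) (hV k) hq (hχt' k) (hdχt' k) (hdχtb' k)
    (hsub' k) (hχ' k) (hs' k) (hsb' k) (hdd' k) (hddb' k) (hs2' k) (hsb2' k) (hdd2' k) (hddb2' k) (hcut' k) (hcutF' k) (hcutB' k) (hV' k) (hhψ k) (hhψf k) ρ₃
  exact hasMaj_idef_glueInv_smoothCutDressed_localGauges_tr blk π sec τ τ' η⁻¹ η'⁻¹ T htri hd hd0 hsymm hrow hσ hcr hβ hβ₁ hct hm₀ hm₁ hoχ hoχ₁ hoχ₂ hR ho hσρ hρ₁V hρ₁G hρ₂ hρ₂₁ hρ₂T hρ₃ hρ₃₂ hρ₃V hρ₃N hσρ₃ hε hc₁ hc₂ ho₁ ho₂ hrW hθW hcN hrN hℓ hω hd₁ hoo hε₀ hrF hNov hn hn' hSχ hSψ hSχ' hSψ' hχt hdχt hdχtb hsub hχ hs hsb hdd hddb hNψ hχt' hdχt' hdχtb' hsub' hχ' hs' hsb'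 hdd' hddb' hNψ' hfitχ hfit₁ hfit₁b hfit₂ hfit₂b hcut hcutF hcutB hcut' hcutF' hcutB' hDcut hDcutF hDcutB hs2 hsb2 hdd2 hddb2 hs2' hsb2' hdd2' hddb2' hV hV' hDV hq hh1 hh1b hh1' hh1b' hh2' hf1 hf1b hf2 hLip hrh hrh' hfh hstep hstep' hDW hKN' hDKN hh2 hW hW' hKN hhabs hhabs' hhcut hhcut' hN hT hT' hDT hugf hugf' hθF' (le_refl (0:ℝ)) hrFK' (le_refl (0:ℝ)) hcov hcov' hFK hFK' hFX hFX' hDFK hDFX hTk hT0 hΨ hs0 hψoχ hψoh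
    (fun k => by rw [← hcov k]; exact hKout k) hSin hSout hq'

end Summit.QuantumFields.YangMills.BalabanUVNodes.N15.CurvedSpecies

end
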